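import Literature.Analysis.Fourier.DiscreteCantorFUP
import Mathlib.Analysis.InnerProductSpace.PiL2
import Mathlib.Algebra.Polynomial.Roots
import Mathlib.LinearAlgebra.Lagrange
import Mathlib.Algebra.Order.Chebyshev
import HarnessLib

/-!
# Fractal uncertainty for discrete Cantor sets — proofs (Dyatlov–Jin 2017, Theorem 2)

Discharge of the named fact `Literature.Analysis.Fourier.dyatlovJin2017_fup` of
`Literature/Analysis/Fourier/DiscreteCantorFUP.lean`:
`theorem dyatlovJin2017_fup_holds : dyatlovJin2017_fup`, sorry-free, from Mathlib and the
already-discharged `dyatlovJin2017_lemma_2_2_holds` (Lemma 2.2, FFT submultiplicativity).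

This file ALSO discharges the named fact `Literature.Analysis.Fourier.dyatlovJin2017_lemma_2_6`
(the quantitative gap lemma, Lemma 2.6 of the same paper):
`theorem dyatlovJin2017_lemma_2_6_holds : dyatlovJin2017_lemma_2_6` — see the section
*Lemma 2.6 (the gap lemma): the quantitative bound* at the end of the file, which follows the
printed proof (shift, generating polynomial, Lagrange interpolation at roots of unity, Plancherel).

S. Dyatlov, L. Jin, *Resonances for open quantum maps and a fractal uncertainty principle*,
Comm. Math. Phys. 354 (2017) 269–316 = arXiv:1608.02238, §2 (pp. 10–12 of the arXiv version read
from the held copy `paper:arxiv-1608.02238`). Bib key `DyatlovJin2017`.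

## The printed proof and this formalisation

Theorem 2 asserts `β := −lim log r_k/(k log M) > max(0, 1/2 − δ)` for
`r_k = ‖𝟙_{𝒞_k} ℱ_N 𝟙_{𝒞_k}‖`, `N = M^k`, `δ = log|𝒜|/log M`; the vendored statement is its
consequence (1.6), `r_k ≤ C_ε N^{−β+ε}` for SOME `β > max(0, 1/2 − δ)` (the limit is not
asserted). The paper proves it (end of §2.3) from:

* (2.7) `r_{k₁+k₂} ≤ r_{k₁} r_{k₂}` — Lemma 2.2 (FFT splitting, Lemma 2.1) with
  `N_i = M^{k_i}`, `X_i = Y_i = 𝒞_{k_i}`; here `cantor_submult`, from `dyatlovJin2017_lemma_2_2_holds`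
  and the mixed-radix decomposition `𝒞_{k₁+k₂} = {ℓ₁ + M^{k₁}ℓ₂}` = `{j₂ + M^{k₂}j₁}`
  (`cantorNat_radix`, `radixSetX_cantor`, `radixSetY_cantor`);
* Proposition 2.3 / (2.9): it suffices to find ONE level `k₀` with
  `−log r_{k₀}/(k₀ log M) > max(0, 1/2 − δ)`; we use only the elementary half of Fekete,
  `r_{nk₀+j} ≤ r_{k₀}^n · r_j ≤ r_{k₀}^n` (`cantor_pow_bound`, trivial bound `fourierSandwichLE_one`
  from Plancherel `sum_norm_sq_dft`), which gives (1.6) with `β := −log r_{k₀}/(k₀ log M)` and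
  `C_ε := M^{k₀β}` for every `ε ≥ 0`;
* Corollary 2.5 (from Lemma 2.4): at level `2` (here: any level `k₀ ≥ 2`) the pair
  `j = ℓ = (a′, a, …)`, `j′ = ℓ′ = (a, a, …)` has `(j − j′)(ℓ − ℓ′) = (a′ − a)² ∉ M^{k₀}ℤ`
  (`cantor_offbeat`), so the Hilbert–Schmidt ("pressure") bound `r_{k₀} ≤ N^{δ−1/2}` is STRICT; we
  need only this qualitative half of Lemma 2.4, proved as the equality case of Cauchy–Schwarz
  (`sum_norm_sq_dft_lt_of_offbeat`, via `norm_inner_eq_norm_iff` in `EuclideanSpace ℂ (ℤ/N)`)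
  instead of the paper's singular-value computation giving the explicit gain `1 − 1/(K N⁴)`;
* Corollary 2.7 (from Lemma 2.6): a missing digit `b ∉ 𝒜` leaves the gap
  `{bM^{k₀−1}, …, (b+1)M^{k₀−1} − 1}` in `𝒞_{k₀}` (`cantor_gap`), of length `≥ |𝒞_{k₀}|` once
  `|𝒜|^{k₀} ≤ M^{k₀−1}` (`exists_level`); then `r_{k₀} < 1` by the root-counting half of the
  proof of Lemma 2.6 (`eq_zero_of_gap`: after a cyclic shift `p(z) = ∑ u(ℓ)z^ℓ` has degree
  `< N − L ≤ N − |X|` and vanishes at the `N − |X|` points `ω^{−k}`, `k ∉ X`), again without the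
  quantitative Lagrange-interpolation bound `√(1 − 2^{−2N})`;
* compactness of the unit sphere of `{u : supp u ⊆ Y}` (`exists_uniform_bound_lt`) turns the two
  pointwise strict inequalities into `r_{k₀} < min(1, N^{δ−1/2}) = M^{−k₀ max(0, 1/2−δ)}`, i.e.
  (2.9).

## References

* S. Dyatlov, L. Jin, Comm. Math. Phys. 354 (2017) = arXiv:1608.02238: Theorem 2, (1.6); §2
  (2.5)–(2.9), Lemmas 2.1, 2.2, 2.4, 2.6, Proposition 2.3, Corollaries 2.5, 2.7. [DyatlovJin2017]
-/

noncomputable section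

open scoped ZMod
open Finset Complex

namespace Literature.Analysis.Fourier

section Basics

variable {N : ℕ} [NeZero N]

/-- `‖χ(j)‖ = 1` for the standard additive character of `ℤ/N` (cf. `norm_stdAddChar` in
`DiscreteSummationByParts`). [folklore] -/
private theorem stdAddChar_norm_eq_one (j : ZMod N) : ‖(ZMod.stdAddChar j : ℂ)‖ = 1 := by
  rw [ZMod.stdAddChar_apply]; exact Circle.norm_coe _

/-- `conj χ(j) = χ(-j)`. [folklore] -/
theorem conj_stdAddChar (j : ZMod N) :
    (starRingEnd ℂ) (ZMod.stdAddChar j) = ZMod.stdAddChar (-j) := by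
  rw [ZMod.stdAddChar_apply, ZMod.stdAddChar_apply, AddChar.map_neg_eq_inv, Circle.coe_inv_eq_conj]

/-- `χ(j) = 1 ↔ j = 0`. [folklore] -/
theorem stdAddChar_eq_one_iff (j : ZMod N) : (ZMod.stdAddChar j : ℂ) = 1 ↔ j = 0 := by
  constructor
  · intro h
    have h' : (ZMod.stdAddChar j : ℂ) = ZMod.stdAddChar (0 : ZMod N) := by
      rw [h, AddChar.map_zero_eq_one]
    exact ZMod.injective_stdAddChar h'
  · rintro rfl; exact AddChar.map_zero_eq_one _

/-- Orthogonality of characters: `∑_i χ(t i) = N` if `t = 0`, else `0`. [folklore] -/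
theorem sum_stdAddChar_mul (t : ZMod N) :
    ∑ i : ZMod N, (ZMod.stdAddChar (t * i) : ℂ) = if t = 0 then (N : ℂ) else 0 := by
  split_ifs with h
  · simp only [h, zero_mul, AddChar.map_zero_eq_one, sum_const, card_univ, ZMod.card,
      nsmul_eq_mul, mul_one]
  · exact AddChar.sum_eq_zero_of_ne_one (ZMod.isPrimitive_stdAddChar N h)

/-- **Plancherel for `ZMod.dft`**: `∑_k ‖𝓕u(k)‖² = N · ∑_j ‖u(j)‖²`. [folklore] -/
theorem sum_norm_sq_dft (u : ZMod N → ℂ) :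
    ∑ k : ZMod N, ‖𝓕 u k‖ ^ 2 = (N : ℝ) * ∑ j : ZMod N, ‖u j‖ ^ 2 := by
  have key : ∀ k : ZMod N, ((‖𝓕 u k‖ : ℝ) : ℂ) ^ 2 =
      ∑ j : ZMod N, ∑ j' : ZMod N,
        u j * (starRingEnd ℂ) (u j') * ZMod.stdAddChar ((j' - j) * k) := by
    intro k
    rw [← Complex.mul_conj', ZMod.dft_apply, map_sum, Finset.sum_mul_sum]
    refine Finset.sum_congr rfl fun j _ => Finset.sum_congr rfl fun j' _ => ?_
    simp only [smul_eq_mul, map_mul, conj_stdAddChar, neg_neg]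
    have : ZMod.stdAddChar (-(j * k)) * ZMod.stdAddChar (j' * k)
        = (ZMod.stdAddChar ((j' - j) * k) : ℂ) := by
      rw [← AddChar.map_add_eq_mul]; congr 1; ring
    calc ZMod.stdAddChar (-(j * k)) * u j * (ZMod.stdAddChar (j' * k) * (starRingEnd ℂ) (u j'))
        = u j * (starRingEnd ℂ) (u j') * (ZMod.stdAddChar (-(j * k)) * ZMod.stdAddChar (j' * k)) := by
          ring
      _ = _ := by rw [this]
  apply Complex.ofReal_injective
  push_cast
  simp_rw [key]
  calc ∑ k : ZMod N, ∑ j : ZMod N, ∑ j' : ZMod N,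
        u j * (starRingEnd ℂ) (u j') * ZMod.stdAddChar ((j' - j) * k)
      = ∑ j : ZMod N, ∑ j' : ZMod N,
          u j * (starRingEnd ℂ) (u j') * ∑ k : ZMod N, (ZMod.stdAddChar ((j' - j) * k) : ℂ) := by
        rw [Finset.sum_comm]
        refine Finset.sum_congr rfl fun j _ => ?_
        rw [Finset.sum_comm]
        refine Finset.sum_congr rfl fun j' _ => ?_
        rw [Finset.mul_sum]
    _ = ∑ j : ZMod N, u j * (starRingEnd ℂ) (u j) * (N : ℂ) := by
        refine Finset.sum_congr rfl fun j _ => ?_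
        simp_rw [sum_stdAddChar_mul, sub_eq_zero, mul_ite, mul_zero]
        rw [Finset.sum_ite_eq']
        simp
    _ = (N : ℂ) * ∑ j : ZMod N, ((‖u j‖ : ℝ) : ℂ) ^ 2 := by
        rw [Finset.mul_sum]
        refine Finset.sum_congr rfl fun j _ => ?_
        rw [Complex.mul_conj']; ring

end Basics


section ZeroBound

variable {N : ℕ} [NeZero N]

/-- The trivial ("zero") bound `‖𝟙_X ℱ_N 𝟙_Y‖ ≤ 1`, from Plancherel.
[cite: DyatlovJin2017, (2.5) (arXiv:1608.02238 §2)] -/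
theorem fourierSandwichLE_one (X Y : Finset (ZMod N)) : FourierSandwichLE N X Y 1 := by
  intro u _
  calc ∑ k ∈ X, ‖𝓕 u k‖ ^ 2 ≤ ∑ k : ZMod N, ‖𝓕 u k‖ ^ 2 :=
        Finset.sum_le_sum_of_subset_of_nonneg (Finset.subset_univ X) fun k _ _ => by positivity
    _ = 1 ^ 2 * (N : ℝ) * ∑ x : ZMod N, ‖u x‖ ^ 2 := by rw [sum_norm_sq_dft]; ring

/-- If the Fourier transform of `u` does not vanish identically off `X`, the frequency mass on
`X` is strictly less than the total mass `N‖u‖²`. [folklore] -/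
theorem sum_norm_sq_dft_lt_of_exists (X : Finset (ZMod N)) (u : ZMod N → ℂ)
    (h : ∃ k, k ∉ X ∧ 𝓕 u k ≠ 0) :
    ∑ k ∈ X, ‖𝓕 u k‖ ^ 2 < (N : ℝ) * ∑ x : ZMod N, ‖u x‖ ^ 2 := by
  classical
  obtain ⟨k₀, hk₀X, hk₀⟩ := h
  rw [← sum_norm_sq_dft, ← Finset.sum_add_sum_compl X]
  have hpos : 0 < ∑ k ∈ Xᶜ, ‖𝓕 u k‖ ^ 2 := by
    refine lt_of_lt_of_le (by positivity : (0 : ℝ) < ‖𝓕 u k₀‖ ^ 2) ?_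
    exact Finset.single_le_sum (f := fun k => ‖𝓕 u k‖ ^ 2) (fun k _ => by positivity)
      (Finset.mem_compl.mpr hk₀X)
  linarith

/-- A sum over `ZMod N` is the sum over the representatives `0, …, N − 1`. [folklore] -/
theorem sum_zmod_eq_sum_range {β : Type*} [AddCommMonoid β] (f : ZMod N → β) :
    ∑ x : ZMod N, f x = ∑ m ∈ Finset.range N, f (m : ZMod N) := by
  refine (Finset.sum_nbij' (fun m : ℕ => (m : ZMod N)) (fun x : ZMod N => x.val) ?_ ?_ ?_ ?_ ?_).symm
  · intro m _; exact Finset.mem_univ _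
  · intro x _; exact Finset.mem_range.mpr (ZMod.val_lt x)
  · intro m hm; exact ZMod.val_cast_of_lt (Finset.mem_range.mp hm)
  · intro x _; exact ZMod.natCast_zmod_val x
  · intro m _; rfl

/-- Translating `u` multiplies its Fourier transform by a character:
`𝓕(u(· + t))(k) = χ(tk) 𝓕u(k)` (the circular shift is conjugated by the Fourier transform to a
multiplication operator, [DyatlovJin2017, §2, proof of (2.9)]). [folklore] -/
theorem dft_comp_add_right (u : ZMod N → ℂ) (t k : ZMod N) :
    𝓕 (fun x => u (x + t)) k = ZMod.stdAddChar (t * k) * 𝓕 u k := by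
  rw [ZMod.dft_apply, ZMod.dft_apply, Finset.mul_sum]
  refine Fintype.sum_equiv (Equiv.addRight t) _ _ fun x => ?_
  simp only [Equiv.coe_addRight, smul_eq_mul]
  rw [← mul_assoc, ← AddChar.map_add_eq_mul]
  congr 2; ring

/-- **Qualitative Lemma 2.6 of [DyatlovJin2017]** (root counting). If `|X| ≤ L < N` and `Y` has a
gap `j, j+1, …, j+L−1 ∉ Y`, then a function supported in `Y` whose Fourier transform is supported
in `X` vanishes: after a cyclic shift `supp u ⊆ {0,…,N−L−1}`, so `p(z) = ∑ u(ℓ) z^ℓ` has degree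
`< N − L ≤ N − |X|` but vanishes at the `N − |X|` roots of unity `ω^{-k}`, `k ∉ X`.
[cite: DyatlovJin2017, Lemma 2.6 (arXiv:1608.02238 §2.3), first half of the proof] -/
theorem eq_zero_of_gap (X Y : Finset (ZMod N)) (L : ℕ) (hXL : X.card ≤ L) (hLN : L < N)
    (j : ZMod N) (hgap : ∀ i : ℕ, i < L → j + (i : ZMod N) ∉ Y)
    (u : ZMod N → ℂ) (hu : ∀ x, x ∉ Y → u x = 0) (hX : ∀ k, k ∉ X → 𝓕 u k = 0) : u = 0 := by
  classical
  -- shift: `u' x = u (x + t)` with `t = j + L` is supported in `{x | x.val < N - L}`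
  set t : ZMod N := j + (L : ZMod N) with ht
  set u' : ZMod N → ℂ := fun x => u (x + t) with hu'
  have hu'top : ∀ x : ZMod N, N - L ≤ x.val → u' x = 0 := by
    intro x hx
    have hxN : x.val < N := ZMod.val_lt x
    obtain ⟨i, hi, hxi⟩ : ∃ i : ℕ, i < L ∧ x.val = N - L + i := ⟨x.val - (N - L), by omega, by omega⟩
    apply hu
    have : x + t = j + (i : ZMod N) := by
      have hx' : (x : ZMod N) = ((x.val : ℕ) : ZMod N) := (ZMod.natCast_zmod_val x).symm
      rw [ht, hx', hxi]
      have hNL : ((N - L : ℕ) : ZMod N) = -(L : ZMod N) := by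
        rw [Nat.cast_sub hLN.le, ZMod.natCast_self, zero_sub]
      push_cast
      rw [hNL]; ring
    rw [this]
    exact hgap i hi
  have hX' : ∀ k, k ∉ X → 𝓕 u' k = 0 := by
    intro k hk
    rw [hu', dft_comp_add_right, hX k hk, mul_zero]
  -- the polynomial `p(z) = ∑_{m < N - L} u'(m) z^m`
  set p : Polynomial ℂ := ∑ m ∈ Finset.range (N - L), Polynomial.C (u' m) * Polynomial.X ^ m
    with hp
  have hp_eval : ∀ k : ZMod N, p.eval (ZMod.stdAddChar (-k)) = 𝓕 u' k := by
    intro k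
    rw [hp, Polynomial.eval_finsetSum, ZMod.dft_apply, sum_zmod_eq_sum_range]
    simp only [Polynomial.eval_mul, Polynomial.eval_C, Polynomial.eval_pow, Polynomial.eval_X,
      smul_eq_mul]
    have hsplit : Finset.range N = Finset.range (N - L) ∪ Finset.Ico (N - L) N := by
      simp only [Finset.range_eq_Ico]
      exact (Finset.Ico_union_Ico_eq_Ico (Nat.zero_le _) (Nat.sub_le N L)).symm
    rw [hsplit, Finset.sum_union]
    · rw [Finset.sum_eq_zero (s := Finset.Ico (N - L) N), add_zero]
      · refine Finset.sum_congr rfl fun m _ => ?_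
        rw [← AddChar.map_nsmul_eq_pow, mul_comm]
        congr 2
        simp only [nsmul_eq_mul]; ring
      · intro m hm
        rw [Finset.mem_Ico] at hm
        rw [hu'top, mul_zero]
        rw [ZMod.val_cast_of_lt hm.2]; exact hm.1
    · rw [Finset.range_eq_Ico]
      exact Finset.Ico_disjoint_Ico_consecutive 0 (N - L) N
  have hp_deg : p.natDegree < N - X.card := by
    have : p.natDegree ≤ N - L - 1 := by
      rw [hp]
      refine Polynomial.natDegree_sum_le_of_forall_le _ _ fun m hm => ?_
      refine (Polynomial.natDegree_C_mul_X_pow_le _ _).trans ?_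
      have := Finset.mem_range.mp hm; omega
    omega
  have hp_zero : p = 0 := by
    refine Polynomial.eq_zero_of_natDegree_lt_card_of_eval_eq_zero p
      (f := fun k : (Xᶜ : Finset (ZMod N)) => (ZMod.stdAddChar (-(k : ZMod N)) : ℂ)) ?_ ?_ ?_
    · intro a b hab
      have := ZMod.injective_stdAddChar hab
      exact Subtype.ext (neg_injective this)
    · rintro ⟨k, hk⟩
      rw [hp_eval]
      exact hX' k (Finset.mem_compl.mp hk)
    · rw [Fintype.card_coe, Finset.card_compl, ZMod.card]; exact hp_deg
  have hu'zero : ∀ x : ZMod N, u' x = 0 := by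
    intro x
    by_cases hx : N - L ≤ x.val
    · exact hu'top x hx
    · push Not at hx
      have hcoeff : p.coeff x.val = u' x := by
        rw [hp, Polynomial.finsetSum_coeff]
        simp only [Polynomial.coeff_C_mul, Polynomial.coeff_X_pow, mul_ite, mul_one, mul_zero]
        rw [Finset.sum_ite_eq, if_pos (Finset.mem_range.mpr hx), ZMod.natCast_zmod_val]
      rw [← hcoeff, hp_zero, Polynomial.coeff_zero]
  funext y
  have := hu'zero (y - t)
  simpa [hu'] using this

/-- Quantitative-free form used below: under the gap hypothesis every nonzero `u` supported in `Y`
has Fourier mass on `X` strictly below `N‖u‖²`. [cite: DyatlovJin2017, Lemma 2.6, qualitative part] -/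
theorem sum_norm_sq_dft_lt_of_gap (X Y : Finset (ZMod N)) (L : ℕ) (hXL : X.card ≤ L) (hLN : L < N)
    (j : ZMod N) (hgap : ∀ i : ℕ, i < L → j + (i : ZMod N) ∉ Y)
    (u : ZMod N → ℂ) (hu : ∀ x, x ∉ Y → u x = 0) (hne : u ≠ 0) :
    ∑ k ∈ X, ‖𝓕 u k‖ ^ 2 < (N : ℝ) * ∑ x : ZMod N, ‖u x‖ ^ 2 := by
  apply sum_norm_sq_dft_lt_of_exists
  by_contra hcon
  push Not at hcon
  exact hne (eq_zero_of_gap X Y L hXL hLN j hgap u hu hcon)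

end ZeroBound


section PressureBound

variable {N : ℕ} [NeZero N]

/-! The test vectors `e_k = 𝟙_Y · χ(· k) ∈ ℓ²(ℤ/N)` satisfy `⟨e_k, u⟩ = 𝓕u(k)` for `u` supported
in `Y` and `‖e_k‖² = |Y|`; Cauchy–Schwarz then gives the Hilbert–Schmidt bound and its equality
case. (We keep `e_k` as an explicit term rather than a definition.) -/

/-- `⟨e_k, u⟩ = 𝓕u(k)` for `u` supported in `Y`, where `e_k = 𝟙_Y · χ(· k)`. [folklore] -/
private theorem inner_testVec (Y : Finset (ZMod N)) (k : ZMod N) (u : ZMod N → ℂ)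
    (hu : ∀ x, x ∉ Y → u x = 0) :
    inner ℂ (WithLp.toLp 2 fun x => if x ∈ Y then (ZMod.stdAddChar (x * k) : ℂ) else 0 :
        EuclideanSpace ℂ (ZMod N))
      (WithLp.toLp 2 u : EuclideanSpace ℂ (ZMod N)) = 𝓕 u k := by
  rw [PiLp.inner_apply, ZMod.dft_apply]
  refine Finset.sum_congr rfl fun x _ => ?_
  rw [WithLp.ofLp_toLp, RCLike.inner_apply', smul_eq_mul, WithLp.ofLp_toLp]
  by_cases hx : x ∈ Y
  · rw [if_pos hx, conj_stdAddChar]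
  · rw [if_neg hx, hu x hx, map_zero, zero_mul, mul_zero]

/-- `‖e_k‖² = |Y|` for `e_k = 𝟙_Y · χ(· k)`. [folklore] -/
private theorem norm_sq_testVec (Y : Finset (ZMod N)) (k : ZMod N) :
    ‖(WithLp.toLp 2 fun x => if x ∈ Y then (ZMod.stdAddChar (x * k) : ℂ) else 0 :
        EuclideanSpace ℂ (ZMod N))‖ ^ 2 = (Y.card : ℝ) := by
  classical
  rw [EuclideanSpace.norm_sq_eq]
  have : ∀ x : ZMod N, ‖(WithLp.toLp 2 fun x => if x ∈ Y then (ZMod.stdAddChar (x * k) : ℂ) else 0 :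
        EuclideanSpace ℂ (ZMod N)) x‖ ^ 2 = if x ∈ Y then (1 : ℝ) else 0 := by
    intro x
    rw [WithLp.ofLp_toLp]
    split_ifs
    · rw [stdAddChar_norm_eq_one, one_pow]
    · simp
  simp_rw [this]
  rw [Finset.sum_boole, Finset.filter_mem_eq_inter, Finset.univ_inter]

/-- `e_k ≠ 0` as soon as `Y` is nonempty. [folklore] -/
private theorem testVec_ne_zero (Y : Finset (ZMod N)) (k : ZMod N) {l : ZMod N} (hl : l ∈ Y) :
    (WithLp.toLp 2 fun x => if x ∈ Y then (ZMod.stdAddChar (x * k) : ℂ) else 0 :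
        EuclideanSpace ℂ (ZMod N)) ≠ 0 := by
  intro h0
  have := congrArg (fun v : EuclideanSpace ℂ (ZMod N) => v l) h0
  simp only [if_pos hl, WithLp.ofLp_zero, Pi.zero_apply] at this
  have hn := stdAddChar_norm_eq_one (l * k)
  rw [this, norm_zero] at hn
  exact zero_ne_one hn

/-- The `ℓ²` norm of `u` viewed in `EuclideanSpace ℂ (ZMod N)`. [folklore] -/
private theorem norm_sq_toLp (u : ZMod N → ℂ) :
    ‖(WithLp.toLp 2 u : EuclideanSpace ℂ (ZMod N))‖ ^ 2 = ∑ x : ZMod N, ‖u x‖ ^ 2 := by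
  rw [EuclideanSpace.norm_sq_eq]

/-- The Hilbert–Schmidt / Cauchy–Schwarz bound at one frequency: `‖𝓕u(k)‖² ≤ |Y| ‖u‖²` for `u`
supported in `Y`. [cite: DyatlovJin2017, (2.6)–(2.7) (arXiv:1608.02238 §2)] -/
theorem norm_sq_dft_le_card_mul (Y : Finset (ZMod N)) (u : ZMod N → ℂ)
    (hu : ∀ x, x ∉ Y → u x = 0) (k : ZMod N) :
    ‖𝓕 u k‖ ^ 2 ≤ (Y.card : ℝ) * ∑ x : ZMod N, ‖u x‖ ^ 2 := by
  rw [← inner_testVec Y k u hu, ← norm_sq_testVec Y k, ← norm_sq_toLp u, ← mul_pow]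
  exact pow_le_pow_left₀ (norm_nonneg _) (norm_inner_le_norm _ _) 2

/-- The Hilbert–Schmidt ("pressure") bound `‖𝟙_X ℱ_N 𝟙_Y‖² ≤ |X||Y|/N` in quadratic form.
[cite: DyatlovJin2017, (2.6)–(2.7) (arXiv:1608.02238 §2)] -/
theorem sum_norm_sq_dft_le_card_mul_card (X Y : Finset (ZMod N)) (u : ZMod N → ℂ)
    (hu : ∀ x, x ∉ Y → u x = 0) :
    ∑ k ∈ X, ‖𝓕 u k‖ ^ 2 ≤ (X.card : ℝ) * Y.card * ∑ x : ZMod N, ‖u x‖ ^ 2 := by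
  calc ∑ k ∈ X, ‖𝓕 u k‖ ^ 2 ≤ ∑ _k ∈ X, (Y.card : ℝ) * ∑ x : ZMod N, ‖u x‖ ^ 2 :=
        Finset.sum_le_sum fun k _ => norm_sq_dft_le_card_mul Y u hu k
    _ = _ := by rw [Finset.sum_const, nsmul_eq_mul]; ring

/-- **Qualitative Lemma 2.4 of [DyatlovJin2017]** (strict improvement over the pressure bound).
If `j, j' ∈ X`, `ℓ, ℓ' ∈ Y` with `(j − j')(ℓ − ℓ') ∉ Nℤ`, then for every nonzero `u` supported
in `Y`, `∑_{k∈X} ‖𝓕u(k)‖² < |X||Y| ‖u‖²`: equality would force equality in Cauchy–Schwarz at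
`k = j` and `k = j'`, i.e. `u ∥ χ(· j)` and `u ∥ χ(· j')` on `Y`, whence `χ((j−j')(ℓ−ℓ')) = 1`.
[cite: DyatlovJin2017, Lemma 2.4 (arXiv:1608.02238 §2.2), rank/equality case] -/
theorem sum_norm_sq_dft_lt_of_offbeat (X Y : Finset (ZMod N)) {j j' l l' : ZMod N}
    (hj : j ∈ X) (hj' : j' ∈ X) (hl : l ∈ Y) (hl' : l' ∈ Y) (hoff : (j - j') * (l - l') ≠ 0)
    (u : ZMod N → ℂ) (hu : ∀ x, x ∉ Y → u x = 0) (hne : u ≠ 0) :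
    ∑ k ∈ X, ‖𝓕 u k‖ ^ 2 < (X.card : ℝ) * Y.card * ∑ x : ZMod N, ‖u x‖ ^ 2 := by
  classical
  set S : ℝ := ∑ x : ZMod N, ‖u x‖ ^ 2 with hS
  have hle : ∀ k ∈ X, ‖𝓕 u k‖ ^ 2 ≤ (Y.card : ℝ) * S := fun k _ => norm_sq_dft_le_card_mul Y u hu k
  have hlt : ∃ k ∈ X, ‖𝓕 u k‖ ^ 2 < (Y.card : ℝ) * S := by
    by_contra hcon
    push Not at hcon
    -- equality in Cauchy–Schwarz at `j` and at `j'`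
    set U : EuclideanSpace ℂ (ZMod N) := WithLp.toLp 2 u with hU
    have hU0 : U ≠ 0 := by
      intro h0; apply hne; funext x
      have := congrArg (fun v : EuclideanSpace ℂ (ZMod N) => v x) h0
      simpa [hU] using this
    have heq : ∀ k ∈ X, ∃ r : ℂ, r ≠ 0 ∧ U = r • (WithLp.toLp 2 fun x =>
        if x ∈ Y then (ZMod.stdAddChar (x * k) : ℂ) else 0 : EuclideanSpace ℂ (ZMod N)) := by
      intro k hk
      have h1 : ‖inner ℂ (WithLp.toLp 2 fun x => if x ∈ Y then (ZMod.stdAddChar (x * k) : ℂ) else 0 :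
            EuclideanSpace ℂ (ZMod N)) U‖
          = ‖(WithLp.toLp 2 fun x => if x ∈ Y then (ZMod.stdAddChar (x * k) : ℂ) else 0 :
            EuclideanSpace ℂ (ZMod N))‖ * ‖U‖ := by
        have hsq : ‖inner ℂ (WithLp.toLp 2 fun x =>
              if x ∈ Y then (ZMod.stdAddChar (x * k) : ℂ) else 0 : EuclideanSpace ℂ (ZMod N)) U‖ ^ 2
            = (‖(WithLp.toLp 2 fun x => if x ∈ Y then (ZMod.stdAddChar (x * k) : ℂ) else 0 :
              EuclideanSpace ℂ (ZMod N))‖ * ‖U‖) ^ 2 := by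
          apply le_antisymm
          · exact pow_le_pow_left₀ (norm_nonneg _) (norm_inner_le_norm _ _) 2
          · rw [mul_pow, norm_sq_testVec, hU, norm_sq_toLp, inner_testVec Y k u hu]
            exact hcon k hk
        exact (pow_left_inj₀ (norm_nonneg _) (by positivity) two_ne_zero).mp hsq
      exact (norm_inner_eq_norm_iff (testVec_ne_zero Y k hl) hU0).mp h1
    obtain ⟨r, hr, hrU⟩ := heq j hj
    obtain ⟨r', hr', hr'U⟩ := heq j' hj'
    have hval : ∀ x ∈ Y, ∀ (k : ZMod N) (c : ℂ), U = c • (WithLp.toLp 2 fun x =>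
        if x ∈ Y then (ZMod.stdAddChar (x * k) : ℂ) else 0 : EuclideanSpace ℂ (ZMod N)) →
        u x = c * ZMod.stdAddChar (x * k) := by
      intro x hx k c hc
      have := congrArg (fun v : EuclideanSpace ℂ (ZMod N) => v x) hc
      simpa [hU, if_pos hx] using this
    have e1 := hval l hl j r hrU
    have e2 := hval l hl j' r' hr'U
    have e3 := hval l' hl' j r hrU
    have e4 := hval l' hl' j' r' hr'U
    -- `r χ(lj) = r' χ(lj')`, `r χ(l'j) = r' χ(l'j')` ⇒ `χ(lj + l'j') = χ(lj' + l'j)`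
    have key : (ZMod.stdAddChar (l * j) : ℂ) * ZMod.stdAddChar (l' * j')
        = ZMod.stdAddChar (l * j') * ZMod.stdAddChar (l' * j) := by
      have hrr : (r * r' : ℂ) ≠ 0 := mul_ne_zero hr hr'
      apply mul_left_cancel₀ hrr
      calc r * r' * (ZMod.stdAddChar (l * j) * ZMod.stdAddChar (l' * j'))
          = (r * ZMod.stdAddChar (l * j)) * (r' * ZMod.stdAddChar (l' * j')) := by ring
        _ = (r' * ZMod.stdAddChar (l * j')) * (r * ZMod.stdAddChar (l' * j)) := by
            rw [← e1, ← e4, e2, e3]  -- both sides are `u l * u l'`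
        _ = r * r' * (ZMod.stdAddChar (l * j') * ZMod.stdAddChar (l' * j)) := by ring
    rw [← AddChar.map_add_eq_mul, ← AddChar.map_add_eq_mul] at key
    have key' := ZMod.injective_stdAddChar key
    apply hoff
    linear_combination key'
  calc ∑ k ∈ X, ‖𝓕 u k‖ ^ 2 < ∑ _k ∈ X, (Y.card : ℝ) * S := Finset.sum_lt_sum hle hlt
    _ = _ := by rw [Finset.sum_const, nsmul_eq_mul]; ring

end PressureBound


section Compactness

variable {N : ℕ} [NeZero N]

/-- Homogeneity of the position mass `∑‖u‖²` under scalars. [folklore] -/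
private theorem sum_norm_sq_smul (c : ℂ) (u : ZMod N → ℂ) :
    ∑ x : ZMod N, ‖(c • u) x‖ ^ 2 = ‖c‖ ^ 2 * ∑ x : ZMod N, ‖u x‖ ^ 2 := by
  rw [Finset.mul_sum]
  refine Finset.sum_congr rfl fun x _ => ?_
  rw [Pi.smul_apply, smul_eq_mul, norm_mul, mul_pow]

/-- Homogeneity of the frequency mass on `X` under scalars. [folklore] -/
private theorem sum_norm_sq_dft_smul (X : Finset (ZMod N)) (c : ℂ) (u : ZMod N → ℂ) :
    ∑ k ∈ X, ‖𝓕 (c • u) k‖ ^ 2 = ‖c‖ ^ 2 * ∑ k ∈ X, ‖𝓕 u k‖ ^ 2 := by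
  rw [Finset.mul_sum]
  refine Finset.sum_congr rfl fun k _ => ?_
  rw [LinearEquiv.map_smul, Pi.smul_apply, smul_eq_mul, norm_mul, mul_pow]

/-- `∑‖u(x)‖² = 0` forces `u = 0`. [folklore] -/
private theorem eq_zero_of_sum_norm_sq_eq_zero (u : ZMod N → ℂ)
    (h : ∑ x : ZMod N, ‖u x‖ ^ 2 = 0) : u = 0 := by
  funext x
  have := (Finset.sum_eq_zero_iff_of_nonneg fun y _ => sq_nonneg ‖u y‖).mp h x (Finset.mem_univ x)
  simpa using this

/-- **Compactness step.** On the finite-dimensional space of functions supported in `Y`, a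
pointwise strict bound `∑_{k∈X} ‖𝓕u(k)‖² < B‖u‖²` (`u ≠ 0`) improves to a uniform one with some
constant `B' < B` (the supremum (2.8) of [DyatlovJin2017, §2] is attained on the unit sphere).
[folklore] -/
theorem exists_uniform_bound_lt (X Y : Finset (ZMod N)) (B : ℝ) (hB : 0 < B)
    (h : ∀ u : ZMod N → ℂ, (∀ x, x ∉ Y → u x = 0) → u ≠ 0 →
      ∑ k ∈ X, ‖𝓕 u k‖ ^ 2 < B * ∑ x : ZMod N, ‖u x‖ ^ 2) :
    ∃ B' : ℝ, 0 ≤ B' ∧ B' < B ∧ ∀ u : ZMod N → ℂ, (∀ x, x ∉ Y → u x = 0) →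
      ∑ k ∈ X, ‖𝓕 u k‖ ^ 2 ≤ B' * ∑ x : ZMod N, ‖u x‖ ^ 2 := by
  classical
  set F : (ZMod N → ℂ) → ℝ := fun u => ∑ k ∈ X, ‖𝓕 u k‖ ^ 2 with hF
  set Q : (ZMod N → ℂ) → ℝ := fun u => ∑ x : ZMod N, ‖u x‖ ^ 2 with hQ
  set S : Set (ZMod N → ℂ) := {u | (∀ x, x ∉ Y → u x = 0) ∧ Q u = 1} with hSdef
  have hFc : Continuous F := by
    refine continuous_finsetSum _ fun k _ => (continuous_norm.comp ?_).pow 2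
    simp only [ZMod.dft_apply, smul_eq_mul]
    exact continuous_finsetSum _ fun j _ => continuous_const.mul (continuous_apply j)
  have hQc : Continuous Q :=
    continuous_finsetSum _ fun x _ => (continuous_norm.comp (continuous_apply x)).pow 2
  have hS_closed : IsClosed S := by
    have : S = (⋂ x ∈ (Yᶜ : Finset (ZMod N)), {u : ZMod N → ℂ | u x = 0}) ∩ Q ⁻¹' {1} := by
      ext u; simp [hSdef]
    rw [this]
    refine IsClosed.inter (isClosed_biInter fun x _ => isClosed_eq (continuous_apply x)
      continuous_const) (isClosed_eq hQc continuous_const)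
  have hS_bdd : Bornology.IsBounded S := by
    refine (Metric.isBounded_iff_subset_closedBall 0).mpr ⟨1, fun u hu => ?_⟩
    rw [mem_closedBall_zero_iff, pi_norm_le_iff_of_nonneg zero_le_one]
    intro x
    have hx : ‖u x‖ ^ 2 ≤ 1 := by
      rw [← hu.2]
      exact Finset.single_le_sum (f := fun y => ‖u y‖ ^ 2) (fun y _ => sq_nonneg _)
        (Finset.mem_univ x)
    exact (sq_le_one_iff₀ (norm_nonneg _)).mp hx
  have hS_cpt : IsCompact S := Metric.isCompact_of_isClosed_isBounded hS_closed hS_bdd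
  -- normalisation of a nonzero supported function lands in `S`
  have hnorm : ∀ u : ZMod N → ℂ, (∀ x, x ∉ Y → u x = 0) → Q u ≠ 0 →
      (((Real.sqrt (Q u))⁻¹ : ℝ) : ℂ) • u ∈ S ∧
        F u = Q u * F ((((Real.sqrt (Q u))⁻¹ : ℝ) : ℂ) • u) := by
    intro u hu hq
    have hqpos : 0 < Q u := lt_of_le_of_ne (Finset.sum_nonneg fun y _ => sq_nonneg _) (Ne.symm hq)
    have hc : ‖(((Real.sqrt (Q u))⁻¹ : ℝ) : ℂ)‖ ^ 2 = (Q u)⁻¹ := by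
      rw [Complex.norm_real, Real.norm_eq_abs, abs_inv, abs_of_nonneg (Real.sqrt_nonneg _),
        inv_pow, Real.sq_sqrt hqpos.le]
    refine ⟨⟨fun x hx => by simp [hu x hx], ?_⟩, ?_⟩
    · show ∑ x : ZMod N, ‖((((Real.sqrt (Q u))⁻¹ : ℝ) : ℂ) • u) x‖ ^ 2 = 1
      rw [sum_norm_sq_smul, hc]
      exact inv_mul_cancel₀ hq
    · show ∑ k ∈ X, ‖𝓕 u k‖ ^ 2 = Q u * ∑ k ∈ X, ‖𝓕 ((((Real.sqrt (Q u))⁻¹ : ℝ) : ℂ) • u) k‖ ^ 2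
      rw [sum_norm_sq_dft_smul, hc, ← mul_assoc, mul_inv_cancel₀ hq, one_mul]
  by_cases hSne : S.Nonempty
  · obtain ⟨u₀, hu₀S, hmax⟩ := hS_cpt.exists_isMaxOn hSne hFc.continuousOn
    have hu₀ne : u₀ ≠ 0 := by
      rintro rfl
      have := hu₀S.2
      simp [hQ] at this
    have hFu₀ : F u₀ < B := by
      have := h u₀ hu₀S.1 hu₀ne
      rw [show (∑ x : ZMod N, ‖u₀ x‖ ^ 2) = Q u₀ from rfl, hu₀S.2, mul_one] at this
      exact this
    refine ⟨F u₀, Finset.sum_nonneg fun k _ => sq_nonneg _, hFu₀, fun u hu => ?_⟩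
    by_cases hq : Q u = 0
    · have hu0 : u = 0 := eq_zero_of_sum_norm_sq_eq_zero u hq
      subst hu0
      show ∑ k ∈ X, ‖𝓕 (0 : ZMod N → ℂ) k‖ ^ 2 ≤ F u₀ * ∑ x : ZMod N, ‖(0 : ZMod N → ℂ) x‖ ^ 2
      simp [map_zero]
    · obtain ⟨hvS, hFv⟩ := hnorm u hu hq
      have hle := hmax hvS
      have hqpos : 0 < Q u := lt_of_le_of_ne (Finset.sum_nonneg fun y _ => sq_nonneg _) (Ne.symm hq)
      show F u ≤ F u₀ * Q u
      rw [hFv, mul_comm]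
      exact mul_le_mul_of_nonneg_right hle hqpos.le
  · refine ⟨0, le_rfl, hB, fun u hu => ?_⟩
    by_cases hq : Q u = 0
    · have hu0 : u = 0 := eq_zero_of_sum_norm_sq_eq_zero u hq
      subst hu0
      simp [map_zero]
    · exact absurd ⟨_, (hnorm u hu hq).1⟩ hSne

end Compactness


section CantorCombinatorics

/-! ### Cantor sets: mixed-radix decomposition, sizes, gaps, off-beat pairs

The `k`-th order Cantor set as a set of naturals is
`((Fintype.piFinset fun _ : Fin k => 𝒜).image fun a => ∑ j, a j * M ^ j)`; we keep this term
explicit (no auxiliary definition) and relate it to `cantorSet`, `radixSetX`, `radixSetY`. -/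

/-- Naturals below `n` are separated by the cast into `ZMod n`. [folklore] -/
private theorem natCast_zmod_inj_of_lt' {n a b : ℕ} (ha : a < n) (hb : b < n)
    (h : (a : ZMod n) = (b : ZMod n)) : a = b := by
  have := (ZMod.natCast_eq_natCast_iff' a b n).mp h
  rwa [Nat.mod_eq_of_lt ha, Nat.mod_eq_of_lt hb] at this

/-- `cantorSet` is the cast of the natural-number Cantor set. [cite: DyatlovJin2017, (1.4)] -/
private theorem cantorSet_eq_image (M : ℕ) (𝒜 : Finset ℕ) (k : ℕ) :
    cantorSet M 𝒜 k = (((Fintype.piFinset fun _ : Fin k => 𝒜).image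
      fun a : Fin k → ℕ => ∑ j : Fin k, a j * M ^ (j : ℕ))).image
        fun n : ℕ => (n : ZMod (M ^ k)) := by
  rw [cantorSet, Finset.image_image]; rfl

/-- Digit expansions with `k` digits `< M` are `< M^k`. [folklore] -/
private theorem digits_sum_lt {M : ℕ} :
    ∀ (k : ℕ) (a : Fin k → ℕ), (∀ j, a j < M) → ∑ j : Fin k, a j * M ^ (j : ℕ) < M ^ k
  | 0, a, _ => by simp
  | k + 1, a, ha => by
      rw [Fin.sum_univ_castSucc]
      simp only [Fin.val_castSucc, Fin.val_last]
      have h1 := digits_sum_lt k (fun j => a (Fin.castSucc j)) (fun j => ha _)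
      have h2 : a (Fin.last k) + 1 ≤ M := ha _
      calc ∑ j : Fin k, a (Fin.castSucc j) * M ^ (j : ℕ) + a (Fin.last k) * M ^ k
          < M ^ k + a (Fin.last k) * M ^ k := by omega
        _ = (a (Fin.last k) + 1) * M ^ k := by ring
        _ ≤ M * M ^ k := Nat.mul_le_mul_right _ h2
        _ = M ^ (k + 1) := by ring

/-- Elements of the natural-number Cantor set are `< M^k`. [folklore] -/
private theorem cantorNat_lt {M : ℕ} {𝒜 : Finset ℕ} (h𝒜 : ∀ a ∈ 𝒜, a < M) (k : ℕ) :
    ∀ n ∈ ((Fintype.piFinset fun _ : Fin k => 𝒜).image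
      fun a : Fin k → ℕ => ∑ j : Fin k, a j * M ^ (j : ℕ)), n < M ^ k := by
  intro n hn
  obtain ⟨a, ha, rfl⟩ := Finset.mem_image.mp hn
  exact digits_sum_lt k a fun j => h𝒜 _ (Fintype.mem_piFinset.mp ha j)

/-- `|𝒞_k| ≤ |𝒜|^k` (the paper has equality, `|𝒞_k| = N^δ`; the inequality suffices).
[cite: DyatlovJin2017, §2, (2.8)] -/
private theorem card_cantorSet_le (M : ℕ) (𝒜 : Finset ℕ) (k : ℕ) :
    (cantorSet M 𝒜 k).card ≤ 𝒜.card ^ k := by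
  classical
  refine Finset.card_image_le.trans ?_
  rw [Fintype.card_piFinset, Finset.prod_const, Finset.card_univ, Fintype.card_fin]

/-- Mixed-radix decomposition of Cantor sets: `𝒞_{k₁+k₂} = {ℓ₁ + M^{k₁} ℓ₂ : ℓ₁ ∈ 𝒞_{k₁}, ℓ₂ ∈ 𝒞_{k₂}}`
(as sets of naturals). [cite: DyatlovJin2017, §2.1, (2.7) setup] -/
private theorem cantorNat_radix (M : ℕ) (𝒜 : Finset ℕ) (k₁ k₂ : ℕ) :
    (((Fintype.piFinset fun _ : Fin k₁ => 𝒜).image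
        fun a : Fin k₁ → ℕ => ∑ j : Fin k₁, a j * M ^ (j : ℕ)) ×ˢ
      ((Fintype.piFinset fun _ : Fin k₂ => 𝒜).image
        fun a : Fin k₂ → ℕ => ∑ j : Fin k₂, a j * M ^ (j : ℕ))).image
      (fun p : ℕ × ℕ => p.1 + M ^ k₁ * p.2)
    = (Fintype.piFinset fun _ : Fin (k₁ + k₂) => 𝒜).image
        fun a : Fin (k₁ + k₂) → ℕ => ∑ j : Fin (k₁ + k₂), a j * M ^ (j : ℕ) := by
  classical
  ext n
  simp only [Finset.mem_image, Finset.mem_product, Fintype.mem_piFinset, Prod.exists]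
  constructor
  · rintro ⟨n₁, n₂, ⟨⟨a, ha, rfl⟩, ⟨b, hb, rfl⟩⟩, rfl⟩
    refine ⟨Fin.append a b, fun j => ?_, ?_⟩
    · refine Fin.addCases (fun i => ?_) (fun i => ?_) j
      · rw [Fin.append_left]; exact ha i
      · rw [Fin.append_right]; exact hb i
    · rw [Fin.sum_univ_add]
      simp only [Fin.append_left, Fin.append_right, Fin.val_castAdd, Fin.val_natAdd, pow_add,
        Finset.mul_sum]
      congr 1
      exact Finset.sum_congr rfl fun i _ => by ring
  · rintro ⟨c, hc, rfl⟩
    refine ⟨∑ i : Fin k₁, c (Fin.castAdd k₂ i) * M ^ (i : ℕ),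
      ∑ i : Fin k₂, c (Fin.natAdd k₁ i) * M ^ (i : ℕ),
      ⟨⟨fun i => c (Fin.castAdd k₂ i), fun i => hc _, rfl⟩,
        ⟨fun i => c (Fin.natAdd k₁ i), fun i => hc _, rfl⟩⟩, ?_⟩
    rw [Fin.sum_univ_add]
    simp only [Fin.val_castAdd, Fin.val_natAdd, pow_add, Finset.mul_sum]
    congr 1
    exact Finset.sum_congr rfl fun i _ => by ring

/-- Position side: `radixSetY` of two Cantor sets is the next Cantor set.
[cite: DyatlovJin2017, §2.1, setup of (2.7)] -/
private theorem radixSetY_cantor (M : ℕ) (𝒜 : Finset ℕ) (k₁ k₂ : ℕ) :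
    radixSetY (M ^ k₁) (M ^ k₂)
      ((Fintype.piFinset fun _ : Fin k₁ => 𝒜).image
        fun a : Fin k₁ → ℕ => ∑ j : Fin k₁, a j * M ^ (j : ℕ))
      ((Fintype.piFinset fun _ : Fin k₂ => 𝒜).image
        fun a : Fin k₂ → ℕ => ∑ j : Fin k₂, a j * M ^ (j : ℕ))
    = ((Fintype.piFinset fun _ : Fin (k₁ + k₂) => 𝒜).image
        fun a : Fin (k₁ + k₂) → ℕ => ∑ j : Fin (k₁ + k₂), a j * M ^ (j : ℕ)).image
        fun n : ℕ => (n : ZMod (M ^ k₁ * M ^ k₂)) := by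
  rw [radixSetY, ← cantorNat_radix M 𝒜 k₁ k₂, Finset.image_image]; rfl

/-- Frequency side: `radixSetX` of two Cantor sets is the next Cantor set.
[cite: DyatlovJin2017, §2.1, setup of (2.7)] -/
private theorem radixSetX_cantor (M : ℕ) (𝒜 : Finset ℕ) (k₁ k₂ : ℕ) :
    radixSetX (M ^ k₁) (M ^ k₂)
      ((Fintype.piFinset fun _ : Fin k₁ => 𝒜).image
        fun a : Fin k₁ → ℕ => ∑ j : Fin k₁, a j * M ^ (j : ℕ))
      ((Fintype.piFinset fun _ : Fin k₂ => 𝒜).image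
        fun a : Fin k₂ → ℕ => ∑ j : Fin k₂, a j * M ^ (j : ℕ))
    = ((Fintype.piFinset fun _ : Fin (k₁ + k₂) => 𝒜).image
        fun a : Fin (k₁ + k₂) → ℕ => ∑ j : Fin (k₁ + k₂), a j * M ^ (j : ℕ)).image
        fun n : ℕ => (n : ZMod (M ^ k₁ * M ^ k₂)) := by
  classical
  have hswap : ∀ (S T : Finset ℕ),
      (S ×ˢ T).image (fun p : ℕ × ℕ => ((p.2 + M ^ k₂ * p.1 : ℕ) : ZMod (M ^ k₁ * M ^ k₂)))
        = ((T ×ˢ S).image (fun p : ℕ × ℕ => p.1 + M ^ k₂ * p.2)).image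
            fun n : ℕ => (n : ZMod (M ^ k₁ * M ^ k₂)) := by
    intro S T
    rw [Finset.image_image]
    ext x
    simp only [Finset.mem_image, Finset.mem_product, Prod.exists, Function.comp_apply]
    constructor
    · rintro ⟨a, b, ⟨ha, hb⟩, rfl⟩; exact ⟨b, a, ⟨hb, ha⟩, rfl⟩
    · rintro ⟨a, b, ⟨ha, hb⟩, rfl⟩; exact ⟨b, a, ⟨hb, ha⟩, rfl⟩
  rw [radixSetX, hswap, cantorNat_radix M 𝒜 k₂ k₁, Nat.add_comm k₂ k₁]

/-- Transport of a sandwich bound along an equality of levels (for casts of sets of naturals).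
[folklore] -/
private theorem fourierSandwichLE_cast {n n' : ℕ} (h : n = n') [NeZero n] [NeZero n']
    (S T : Finset ℕ) (r : ℝ)
    (H : FourierSandwichLE n (S.image fun m : ℕ => (m : ZMod n)) (T.image fun m : ℕ => (m : ZMod n)) r) :
    FourierSandwichLE n' (S.image fun m : ℕ => (m : ZMod n')) (T.image fun m : ℕ => (m : ZMod n')) r := by
  subst h; exact H

/-- **Submultiplicativity for Cantor sets**, (2.7) of [DyatlovJin2017]: sandwich bounds `r₁` at
level `k₁` and `r₂` at level `k₂` give `r₁r₂` at level `k₁ + k₂` (Lemma 2.2 with `N₁ = M^{k₁}`,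
`N₂ = M^{k₂}`, `X_i = Y_i = 𝒞_{k_i}`). [cite: DyatlovJin2017, (2.7)] -/
private theorem cantor_submult {M : ℕ} {𝒜 : Finset ℕ} (h𝒜 : ∀ a ∈ 𝒜, a < M)
    (k₁ k₂ : ℕ) {r₁ r₂ : ℝ} (hr₁ : 0 ≤ r₁) (hr₂ : 0 ≤ r₂)
    [NeZero (M ^ k₁)] [NeZero (M ^ k₂)] [NeZero (M ^ (k₁ + k₂))]
    (h₁ : FourierSandwichLE (M ^ k₁) (cantorSet M 𝒜 k₁) (cantorSet M 𝒜 k₁) r₁)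
    (h₂ : FourierSandwichLE (M ^ k₂) (cantorSet M 𝒜 k₂) (cantorSet M 𝒜 k₂) r₂) :
    FourierSandwichLE (M ^ (k₁ + k₂)) (cantorSet M 𝒜 (k₁ + k₂)) (cantorSet M 𝒜 (k₁ + k₂))
      (r₁ * r₂) := by
  haveI : NeZero (M ^ k₁ * M ^ k₂) := ⟨by rw [← pow_add]; exact NeZero.ne _⟩
  rw [cantorSet_eq_image] at h₁ h₂
  have H := dyatlovJin2017_lemma_2_2_holds (M ^ k₁) (M ^ k₂) _ _ _ _ r₁ r₂
    (cantorNat_lt h𝒜 k₁) (cantorNat_lt h𝒜 k₁)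
    (cantorNat_lt h𝒜 k₂) (cantorNat_lt h𝒜 k₂) hr₁ hr₂ h₁ h₂
  rw [radixSetX_cantor, radixSetY_cantor] at H
  rw [cantorSet_eq_image]
  exact fourierSandwichLE_cast (pow_add M k₁ k₂).symm _ _ _ H

/-- **The gap of a Cantor set**: if the digit `b` is missing from `𝒜`, then
`bM^k, bM^k + 1, …, (b+1)M^k − 1 ∉ 𝒞_{k+1}`.
[cite: DyatlovJin2017, proof of Corollary 2.7 (arXiv:1608.02238 §2.3)] -/
private theorem cantor_gap {M : ℕ} {𝒜 : Finset ℕ} (h𝒜 : ∀ a ∈ 𝒜, a < M) {b : ℕ} (hbM : b < M)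
    (hb : b ∉ 𝒜) (k : ℕ) [NeZero (M ^ (k + 1))] :
    ∀ i : ℕ, i < M ^ k →
      ((b * M ^ k : ℕ) : ZMod (M ^ (k + 1))) + (i : ZMod (M ^ (k + 1))) ∉ cantorSet M 𝒜 (k + 1) := by
  intro i hi hmem
  rw [cantorSet, Finset.mem_image] at hmem
  obtain ⟨c, hc, hceq⟩ := hmem
  rw [Fintype.mem_piFinset] at hc
  have hMpos : 0 < M ^ k := Nat.pow_pos (by omega)
  have hlt1 : ∑ j : Fin (k + 1), c j * M ^ (j : ℕ) < M ^ (k + 1) :=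
    digits_sum_lt (k + 1) c fun j => h𝒜 _ (hc j)
  have hlt2 : b * M ^ k + i < M ^ (k + 1) := by
    calc b * M ^ k + i < b * M ^ k + M ^ k := by omega
      _ = (b + 1) * M ^ k := by ring
      _ ≤ M * M ^ k := Nat.mul_le_mul_right _ hbM
      _ = M ^ (k + 1) := by ring
  have heq : ∑ j : Fin (k + 1), c j * M ^ (j : ℕ) = b * M ^ k + i := by
    apply natCast_zmod_inj_of_lt' hlt1 hlt2
    rw [hceq]; push_cast; ring
  have htop : (∑ j : Fin (k + 1), c j * M ^ (j : ℕ)) / M ^ k = c (Fin.last k) := by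
    rw [Fin.sum_univ_castSucc]
    simp only [Fin.val_castSucc, Fin.val_last]
    have hlow := digits_sum_lt k (fun j => c (Fin.castSucc j)) fun j => h𝒜 _ (hc _)
    rw [Nat.add_mul_div_right _ _ hMpos, Nat.div_eq_of_lt hlow, zero_add]
  have htop' : (b * M ^ k + i) / M ^ k = b := by
    rw [add_comm, Nat.add_mul_div_right _ _ hMpos, Nat.div_eq_of_lt hi, zero_add]
  rw [heq, htop'] at htop
  exact hb (htop ▸ hc (Fin.last k))

/-- **An off-beat pair in `𝒞_{k+2}`**: for digits `a < a'` of `𝒜` the elements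
`j = ℓ = (a', a, a, …)`, `j' = ℓ' = (a, a, …, a)` satisfy `(j − j')(ℓ − ℓ') = (a' − a)² ∉ M^{k+2}ℤ`.
[cite: DyatlovJin2017, proof of Corollary 2.5 (arXiv:1608.02238 §2.2)] -/
private theorem cantor_offbeat {M : ℕ} {𝒜 : Finset ℕ} (hM : 2 ≤ M) (h𝒜 : ∀ a ∈ 𝒜, a < M)
    {a a' : ℕ} (ha : a ∈ 𝒜) (ha' : a' ∈ 𝒜) (haa' : a < a') (k : ℕ) [NeZero (M ^ (k + 2))] :
    ∃ j ∈ cantorSet M 𝒜 (k + 2), ∃ j' ∈ cantorSet M 𝒜 (k + 2), (j - j') * (j - j') ≠ 0 := by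
  classical
  refine ⟨((∑ i : Fin (k + 2), (if i = 0 then a' else a) * M ^ (i : ℕ) : ℕ) : ZMod (M ^ (k + 2))),
    ?_, ((∑ i : Fin (k + 2), a * M ^ (i : ℕ) : ℕ) : ZMod (M ^ (k + 2))), ?_, ?_⟩
  · refine Finset.mem_image.mpr ⟨fun i => if i = 0 then a' else a,
      Fintype.mem_piFinset.mpr fun i => ?_, rfl⟩
    split_ifs <;> assumption
  · exact Finset.mem_image.mpr ⟨fun _ => a, Fintype.mem_piFinset.mpr fun _ => ha, rfl⟩
  · have hdiff : ((∑ i : Fin (k + 2), (if i = 0 then a' else a) * M ^ (i : ℕ) : ℕ) :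
          ZMod (M ^ (k + 2))) - ((∑ i : Fin (k + 2), a * M ^ (i : ℕ) : ℕ) : ZMod (M ^ (k + 2)))
        = ((a' - a : ℕ) : ZMod (M ^ (k + 2))) := by
      push_cast
      rw [← Finset.sum_sub_distrib, Finset.sum_eq_single (0 : Fin (k + 2))]
      · simp [Nat.cast_sub haa'.le]
      · intro i _ hi; simp [hi]
      · simp
    rw [hdiff, ← Nat.cast_mul, Ne, ZMod.natCast_eq_zero_iff]
    intro hdvd
    have hpos : 0 < (a' - a) * (a' - a) := Nat.mul_pos (by omega) (by omega)
    have hlt : (a' - a) * (a' - a) < M ^ (k + 2) := by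
      have h1 : a' - a < M := by have := h𝒜 a' ha'; omega
      calc (a' - a) * (a' - a) < M * M := Nat.mul_lt_mul'' h1 h1
        _ = M ^ 2 := by ring
        _ ≤ M ^ (k + 2) := Nat.pow_le_pow_right (by omega) (by omega)
    exact absurd (Nat.le_of_dvd hpos hdvd) (not_le.mpr hlt)

/-- Since `|𝒜| < M`, some level `k + 2` has `|𝒜|^{k+2} ≤ M^{k+1}` (`|𝒞_{k+2}|` no larger than the
gap), cf. the condition on `k` in [DyatlovJin2017, Corollary 2.7]. [folklore] -/
private theorem exists_level {M A : ℕ} (hA : A < M) : ∃ k : ℕ, A ^ (k + 2) ≤ M ^ (k + 1) := by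
  have hM0 : (0 : ℝ) < M := by exact_mod_cast (by omega : 0 < M)
  have hAM : (A : ℝ) / M < 1 := by rw [div_lt_one hM0]; exact_mod_cast hA
  have h0 : (0 : ℝ) ≤ (A : ℝ) / M := by positivity
  obtain ⟨n, hn⟩ := exists_pow_lt_of_lt_one (show (0 : ℝ) < 1 / M by positivity) hAM
  refine ⟨n, ?_⟩
  have h1 : ((A : ℝ) / M) ^ (n + 2) < 1 / M :=
    lt_of_le_of_lt (pow_le_pow_of_le_one h0 hAM.le (by omega)) hn
  rw [div_pow, div_lt_div_iff₀ (by positivity) hM0, one_mul] at h1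
  have h2 : A ^ (n + 2) * M < M ^ (n + 1) * M := by
    have : (A : ℝ) ^ (n + 2) * M < (M : ℝ) ^ (n + 1) * M := by
      calc (A : ℝ) ^ (n + 2) * M < (M : ℝ) ^ (n + 2) := h1
        _ = (M : ℝ) ^ (n + 1) * M := by ring
    exact_mod_cast this
  exact (Nat.lt_of_mul_lt_mul_right h2).le

end CantorCombinatorics


section Theorem2

/-- Transport of a Cantor-set sandwich bound along an equality of orders. [folklore] -/
private theorem fourierSandwichLE_cantor_congr {M : ℕ} {𝒜 : Finset ℕ} {k k' : ℕ} (h : k = k')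
    [NeZero (M ^ k)] [NeZero (M ^ k')] {r : ℝ}
    (H : FourierSandwichLE (M ^ k) (cantorSet M 𝒜 k) (cantorSet M 𝒜 k) r) :
    FourierSandwichLE (M ^ k') (cantorSet M 𝒜 k') (cantorSet M 𝒜 k') r := by
  subst h; exact H

/-- Powers of a level bound: from the bound `r` at level `k₀` to `r^m` at level `k₀ m`, i.e.
`r_{k₀m} ≤ r_{k₀}^m`. [cite: DyatlovJin2017, (2.7) iterated / Proposition 2.3 (arXiv:1608.02238 §2.1)] -/
private theorem cantor_pow_bound {M : ℕ} {𝒜 : Finset ℕ} (hM : 2 ≤ M) (h𝒜 : ∀ a ∈ 𝒜, a < M)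
    (k₀ : ℕ) {r : ℝ} (hr : 0 ≤ r) [∀ k : ℕ, NeZero (M ^ k)]
    (h : FourierSandwichLE (M ^ k₀) (cantorSet M 𝒜 k₀) (cantorSet M 𝒜 k₀) r) :
    ∀ m : ℕ, FourierSandwichLE (M ^ (k₀ * m)) (cantorSet M 𝒜 (k₀ * m)) (cantorSet M 𝒜 (k₀ * m))
      (r ^ m)
  | 0 => by rw [pow_zero]; exact fourierSandwichLE_one _ _
  | m + 1 => by
      rw [Nat.mul_succ, pow_succ]
      exact cantor_submult h𝒜 (k₀ * m) k₀ (pow_nonneg hr m) hr (cantor_pow_bound hM h𝒜 k₀ hr h m) h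

/-- **Dyatlov–Jin 2017, Theorem 2** holds (discharge of `dyatlovJin2017_fup`): the fractal
uncertainty principle for discrete Cantor sets with an exponent `β > max(0, 1/2 − δ)`.

Proof (the printed one, [DyatlovJin2017, end of §2.3]): choose a level `k₀ = n + 2` with
`|𝒜|^{k₀} ≤ M^{k₀−1}`. At this level every nonzero `u` supported on `𝒞_{k₀}` has
`∑_{𝒞_{k₀}} ‖𝓕u‖² < N‖u‖²` (gap of length `M^{k₀−1} ≥ |𝒞_{k₀}|` left by a missing digit,
qualitative Lemma 2.6 / Corollary 2.7) and `< |𝒞_{k₀}|²‖u‖²` (off-beat pair `(a′−a)² ∉ M^{k₀}ℤ`,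
qualitative Lemma 2.4 / Corollary 2.5); by compactness `r_{k₀} < min(1, N^{δ−1/2}) = M^{−k₀ max(0,1/2−δ)}`,
so `β := −log r_{k₀}/(k₀ log M) > max(0, 1/2 − δ)` ((2.9)), and submultiplicativity (2.7)
(Lemma 2.2) gives `r_{nk₀+j} ≤ r_{k₀}^n · 1 ≤ M^{k₀β} N^{−β}` for all `k = nk₀ + j`.
[cite: DyatlovJin2017, Theorem 2 with (1.6); §2 (2.7), (2.9), Corollaries 2.5 and 2.7
(arXiv:1608.02238 §§2.1–2.3, pp. 10–12)] -/
theorem dyatlovJin2017_fup_holds : dyatlovJin2017_fup := by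
  intro M 𝒜 hM h𝒜 hcard1 hcardM
  classical
  have hM1 : (1 : ℝ) < M := by exact_mod_cast (by omega : 1 < M)
  have hM0 : (0 : ℝ) < M := by positivity
  have hA0 : (0 : ℝ) < 𝒜.card := by exact_mod_cast (by omega : 0 < 𝒜.card)
  have hlogM : 0 < Real.log M := Real.log_pos hM1
  haveI hMk : ∀ k : ℕ, NeZero (M ^ k) := fun k => ⟨pow_ne_zero _ (by omega)⟩
  -- the level `k₀ = n + 2`
  obtain ⟨n, hn⟩ := exists_level hcardM
  -- a missing digit `b` and two distinct digits `a < a'`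
  obtain ⟨b, hbM, hb⟩ : ∃ b, b < M ∧ b ∉ 𝒜 := by
    by_contra hcon
    push Not at hcon
    have hsub : Finset.range M ⊆ 𝒜 := fun x hx => hcon x (Finset.mem_range.mp hx)
    have := Finset.card_le_card hsub
    rw [Finset.card_range] at this
    omega
  obtain ⟨a, ha, a', ha', haa'⟩ : ∃ a ∈ 𝒜, ∃ a' ∈ 𝒜, a < a' := by
    obtain ⟨a, ha, a', ha', hne⟩ := Finset.one_lt_card.mp hcard1
    rcases lt_or_gt_of_ne hne with h | h
    · exact ⟨a, ha, a', ha', h⟩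
    · exact ⟨a', ha', a, ha, h⟩
  -- pointwise strict bound at level `n + 2` with `B = min N₀ |𝒜|^{2(n+2)}`
  set A : ℝ := (𝒜.card : ℝ) ^ (n + 2) with hA
  have hApos : 0 < A := by positivity
  set N₀ : ℝ := ((M ^ (n + 2) : ℕ) : ℝ) with hN₀
  have hN₀pos : 0 < N₀ := by rw [hN₀]; positivity
  have hN₀one : 1 ≤ N₀ := by rw [hN₀]; exact_mod_cast Nat.one_le_pow _ _ (by omega)
  set B : ℝ := min N₀ (A * A) with hB
  have hBpos : 0 < B := lt_min hN₀pos (by positivity)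
  have hcardC : ((cantorSet M 𝒜 (n + 2)).card : ℝ) ≤ A := by
    rw [hA]; exact_mod_cast card_cantorSet_le M 𝒜 (n + 2)
  have hstrict : ∀ u : ZMod (M ^ (n + 2)) → ℂ, (∀ x, x ∉ cantorSet M 𝒜 (n + 2) → u x = 0) →
      u ≠ 0 → ∑ k ∈ cantorSet M 𝒜 (n + 2), ‖𝓕 u k‖ ^ 2 < B * ∑ x, ‖u x‖ ^ 2 := by
    intro u hu hune
    have hS : 0 ≤ ∑ x, ‖u x‖ ^ 2 := Finset.sum_nonneg fun x _ => sq_nonneg _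
    rw [hB, min_mul_of_nonneg _ _ hS]
    refine lt_min ?_ ?_
    · -- gap of length `M^{n+1}` (missing digit `b`), `|𝒞| ≤ |𝒜|^{n+2} ≤ M^{n+1}`
      have hXL : (cantorSet M 𝒜 (n + 2)).card ≤ M ^ (n + 1) :=
        (card_cantorSet_le M 𝒜 (n + 2)).trans hn
      have hLN : M ^ (n + 1) < M ^ (n + 2) := Nat.pow_lt_pow_right (by omega) (by omega)
      exact sum_norm_sq_dft_lt_of_gap _ _ (M ^ (n + 1)) hXL hLN _
        (cantor_gap h𝒜 hbM hb (n + 1)) u hu hune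
    · -- off-beat pair
      obtain ⟨j, hj, j', hj', hoff⟩ := cantor_offbeat hM h𝒜 ha ha' haa' n
      calc ∑ k ∈ cantorSet M 𝒜 (n + 2), ‖𝓕 u k‖ ^ 2
          < ((cantorSet M 𝒜 (n + 2)).card : ℝ) * (cantorSet M 𝒜 (n + 2)).card * ∑ x, ‖u x‖ ^ 2 :=
            sum_norm_sq_dft_lt_of_offbeat _ _ hj hj' hj hj' hoff u hu hune
        _ ≤ A * A * ∑ x, ‖u x‖ ^ 2 := by
            refine mul_le_mul_of_nonneg_right ?_ hS
            exact mul_le_mul hcardC hcardC (Nat.cast_nonneg _) hApos.le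
  -- compactness: a uniform constant `B' < B`, made positive as `B''`
  obtain ⟨B', hB'0, hB'B, hB'⟩ := exists_uniform_bound_lt _ _ B hBpos hstrict
  set B'' : ℝ := max B' (B / 2) with hB''
  have hB''pos : 0 < B'' := lt_of_lt_of_le (by linarith) (le_max_right _ _)
  have hB''B : B'' < B := max_lt hB'B (by linarith)
  -- the level-`k₀` norm bound `r = √(B''/N₀)`
  set r : ℝ := Real.sqrt (B'' / N₀) with hr
  have hrpos : 0 < r := Real.sqrt_pos.mpr (div_pos hB''pos hN₀pos)
  have hr2 : r ^ 2 * N₀ = B'' := by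
    rw [hr, Real.sq_sqrt (div_pos hB''pos hN₀pos).le, div_mul_cancel₀ _ hN₀pos.ne']
  have hlevel : FourierSandwichLE (M ^ (n + 2)) (cantorSet M 𝒜 (n + 2)) (cantorSet M 𝒜 (n + 2)) r := by
    intro u hu
    refine (hB' u hu).trans ?_
    rw [← hN₀, hr2]
    exact mul_le_mul_of_nonneg_right (le_max_left _ _) (Finset.sum_nonneg fun x _ => sq_nonneg _)
  -- `r < 1` and `r < |𝒜|^{k₀} / √N₀`
  have hr1 : r < 1 := by
    have : r ^ 2 < 1 := by
      have h1 : r ^ 2 * N₀ < N₀ := by rw [hr2]; exact hB''B.trans_le (min_le_left _ _)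
      by_contra hcon
      push Not at hcon
      have := mul_le_mul_of_nonneg_right hcon hN₀pos.le
      linarith
    exact (sq_lt_one_iff₀ hrpos.le).mp this
  have hrA : r < A / Real.sqrt N₀ := by
    have hsq : 0 < Real.sqrt N₀ := Real.sqrt_pos.mpr hN₀pos
    rw [lt_div_iff₀ hsq]
    have h1 : (r * Real.sqrt N₀) ^ 2 < A ^ 2 := by
      rw [mul_pow, Real.sq_sqrt hN₀pos.le, hr2]
      exact hB''B.trans_le ((min_le_right _ _).trans_eq (sq A).symm)
    exact lt_of_pow_lt_pow_left₀ 2 hApos.le h1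
  -- the exponent
  set β : ℝ := -Real.log r / ((n + 2 : ℕ) * Real.log M) with hβ
  have hk₀pos : (0 : ℝ) < ((n + 2 : ℕ) : ℝ) := by positivity
  have hden : 0 < ((n + 2 : ℕ) : ℝ) * Real.log M := mul_pos hk₀pos hlogM
  have hlogr : Real.log r < 0 := Real.log_neg hrpos hr1
  have hβpos : 0 < β := by rw [hβ]; exact div_pos (by linarith) hden
  have hβδ : 1 / 2 - Real.log 𝒜.card / Real.log M < β := by
    -- `log r < log (A/√N₀) = (n+2) log|𝒜| − (n+2) (log M)/2`
    have h1 : Real.log r < Real.log (A / Real.sqrt N₀) := Real.log_lt_log hrpos hrA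
    have h2 : Real.log (A / Real.sqrt N₀)
        = ((n + 2 : ℕ) : ℝ) * Real.log 𝒜.card - ((n + 2 : ℕ) : ℝ) * Real.log M / 2 := by
      rw [Real.log_div hApos.ne' (Real.sqrt_pos.mpr hN₀pos).ne', Real.log_sqrt hN₀pos.le, hA,
        Real.log_pow, hN₀]
      push_cast
      rw [Real.log_pow]; push_cast; ring
    rw [h2] at h1
    rw [hβ, lt_div_iff₀ hden]
    have h3 : (1 / 2 - Real.log 𝒜.card / Real.log M) * (((n + 2 : ℕ) : ℝ) * Real.log M)
        = ((n + 2 : ℕ) : ℝ) * Real.log M / 2 - ((n + 2 : ℕ) : ℝ) * Real.log 𝒜.card := by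
      field_simp
    rw [h3]; linarith
  have hmax : max 0 (1 / 2 - Real.log 𝒜.card / Real.log M) < β := max_lt hβpos hβδ
  -- `r = M^{−k₀β}`
  have hr_eq : r = (M : ℝ) ^ (-(((n + 2 : ℕ) : ℝ) * β)) := by
    have : -(((n + 2 : ℕ) : ℝ) * β) = Real.log r / Real.log M := by
      rw [hβ]; field_simp
    rw [this, Real.rpow_def_of_pos hM0, mul_div_cancel₀ _ hlogM.ne', Real.exp_log hrpos]
  refine ⟨β, hmax, fun ε hε => ⟨(M : ℝ) ^ (((n + 2 : ℕ) : ℝ) * β), by positivity, ?_⟩⟩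
  intro k _
  -- `k = k₀ q + j`, `j < k₀`: bound `r^q · 1` at level `k`
  set q := k / (n + 2) with hq
  have hk : (n + 2) * q + k % (n + 2) = k := Nat.div_add_mod k (n + 2)
  have hj : k % (n + 2) < n + 2 := Nat.mod_lt _ (by omega)
  have hfin : FourierSandwichLE (M ^ k) (cantorSet M 𝒜 k) (cantorSet M 𝒜 k) (r ^ q) := by
    have := cantor_submult h𝒜 ((n + 2) * q) (k % (n + 2)) (pow_nonneg hrpos.le q) zero_le_one
      (cantor_pow_bound hM h𝒜 (n + 2) hrpos.le hlevel q) (fourierSandwichLE_one _ _)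
    rw [mul_one] at this
    exact fourierSandwichLE_cantor_congr hk this
  refine hfin.mono (pow_nonneg hrpos.le q) ?_
  -- `r^q = M^{−k₀βq} ≤ M^{k₀β} (M^k)^{−β} ≤ M^{k₀β} (M^k)^{−β+ε}`
  have hMk1 : (1 : ℝ) ≤ (M : ℝ) ^ k := one_le_pow₀ hM1.le
  have hexp : -(((n + 2 : ℕ) : ℝ) * β) * (q : ℝ) ≤ ((n + 2 : ℕ) : ℝ) * β + (-β) * (k : ℝ) := by
    have hkq : (k : ℝ) ≤ ((n + 2 : ℕ) : ℝ) * (q + 1) := by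
      have : k ≤ (n + 2) * (q + 1) := by
        have := hk; have := hj; nlinarith
      exact_mod_cast this
    nlinarith
  calc r ^ q = (M : ℝ) ^ (-(((n + 2 : ℕ) : ℝ) * β) * (q : ℝ)) := by
        rw [hr_eq, ← Real.rpow_natCast, ← Real.rpow_mul hM0.le]
    _ ≤ (M : ℝ) ^ (((n + 2 : ℕ) : ℝ) * β + (-β) * (k : ℝ)) :=
        Real.rpow_le_rpow_of_exponent_le hM1.le hexp
    _ = (M : ℝ) ^ (((n + 2 : ℕ) : ℝ) * β) * ((M : ℝ) ^ k) ^ (-β) := by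
        rw [Real.rpow_add hM0, ← Real.rpow_natCast (M : ℝ) k, ← Real.rpow_mul hM0.le,
          mul_comm (k : ℝ)]
    _ ≤ (M : ℝ) ^ (((n + 2 : ℕ) : ℝ) * β) * ((M : ℝ) ^ k) ^ (-β + ε) := by
        refine mul_le_mul_of_nonneg_left ?_ (by positivity)
        exact Real.rpow_le_rpow_of_exponent_le hMk1 (by linarith)

end Theorem2


end Literature.Analysis.Fourier

end

/-!
## Lemma 2.6 (the gap lemma): the quantitative bound

This final part of the file discharges the named fact `dyatlovJin2017_lemma_2_6` of
`Literature/Analysis/Fourier/DiscreteCantorFUP.lean`: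

> **Lemma 2.6** (S. Dyatlov, L. Jin, *Resonances for open quantum maps and a fractal uncertainty
> principle*, Comm. Math. Phys. 354 (2017) = arXiv:1608.02238, §2.3). Assume `X, Y ⊂ ℤ_N` and for
> some `L ∈ {1,…,N−1}`: `|X| ≤ L`, and `Y` has a gap of size `L` (`j, …, j+L−1 ∉ Y` for some
> `j ∈ ℤ_N`). Then `‖𝟙_X ℱ_N 𝟙_Y‖_{ℓ²_N → ℓ²_N} ≤ √(1 − 2^{−2N})`.

We follow the printed proof (arXiv:1608.02238, pp. 11–12) step by step, for Mathlib's unnormalised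
transform `𝓕 = ZMod.dft` (`ℱ_N = N^{-1/2} 𝓕`), in the quadratic form `FourierSandwichLE`:

1. *Shift.* With `c = j + L` every `x ∈ Y` has `(x − c).val ≤ N − L − 1` (the gap is moved to the
   top of `{0,…,N−1}`), so the generating polynomial `p(z) = ∑_x u(x) z^{(x−c).val}` of a `u`
   supported in `Y` has degree `< N − L ≤ N − |X|` (`val_sub_lt_of_gap`, `degree_genPoly_lt`).
2. *Fourier transform = values at roots of unity.* `𝓕u(k) = e(−ck/N) · p(v_k)` with the nodes
   `v_k = e(−k/N)` (`= ω_N^k`, `ω_N = exp(−2πi/N)` in the paper), so `‖𝓕u(k)‖ = ‖p(v_k)‖`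
   (`dft_eq_stdAddChar_mul_eval`).
3. *Lagrange interpolation* on the nodes `v_m`, `m ∉ X` (Mathlib's `Lagrange.interpolate`,
   `Lagrange.eq_interpolate`): `p(z) = ∑_{m ∉ X} p(v_m) 𝓛_m(z)`, and for `|z| ≤ 1`,
   `|𝓛_m(z)| ≤ 2^N / N`, using `∏_{m' ≠ m} |v_m − v_{m'}| = N` — the derivative of
   `z^N − 1 = ∏_m (z − v_m)` at a node (Mathlib's `Lagrange.nodal`,
   `Lagrange.eval_nodal_derivative_eval_node_eq`; here `nodal_stdAddChar_neg_eq`,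
   `prod_norm_stdAddChar_sub`, `norm_eval_lagrange_basis_le`).
4. *Cauchy–Schwarz* ("Hölder" in print): `|p(z)|² ≤ (2^{2N}/N) ∑_{m ∉ X} |p(v_m)|²`; summing over
   the `N` nodes `z = v_r`: `∑_r |p(v_r)|² ≤ 2^{2N} ∑_{m ∉ X} |p(v_m)|²`
   (`sum_norm_eval_sq_le_of_degree_lt`, stated for any injective unimodular node system with the
   derivative identity).
5. *Plancherel* `∑_k ‖𝓕u(k)‖² = N‖u‖²` (`sum_norm_sq_dft` above; not in Mathlib) turns this into
   `∑_{k ∈ X} ‖𝓕u(k)‖² ≤ (1 − 2^{−2N}) N ‖u‖²`, i.e. the sandwich bound with `r = √(1 − 2^{−2N})`.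

The hypothesis `1 ≤ L` of the printed statement is not needed by the argument (for `L = 0` the
window `X` is empty) and is simply carried along.

(The qualitative half of Lemma 2.6 — root counting, `r < 1` — is `eq_zero_of_gap` above; the
quantitative constant `√(1 − 2^{−2N})` needs the interpolation argument formalised here.)

### References for this part

* S. Dyatlov, L. Jin, Comm. Math. Phys. 354 (2017) 269–316 = arXiv:1608.02238, §2.3, Lemma 2.6
  and its proof (pp. 11–12 of the arXiv version). [DyatlovJin2017]
-/

noncomputable section

open Finset Polynomial ZMod
open scoped ComplexConjugate

namespace Literature.Analysis.Fourier

section Nodes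

variable {N : ℕ} [NeZero N]

/-! ### The nodes `v_m = e(−m/N)` -/

/-- The nodes `v_m = e(−m/N)`, `m ∈ ℤ/N`, are the `N` roots of `z^N − 1`:
`∏_m (z − v_m) = z^N − 1` (as Mathlib's `Lagrange.nodal`). [folklore] -/
private theorem nodal_stdAddChar_neg_eq :
    Lagrange.nodal (univ : Finset (ZMod N)) (fun m : ZMod N => (stdAddChar (-m) : ℂ))
      = X ^ N - 1 := by
  have hN : 0 < N := Nat.pos_of_ne_zero (NeZero.ne N)
  have h : degree (1 : ℂ[X]) < degree ((X : ℂ[X]) ^ N) := by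
    rw [degree_one, degree_X_pow]; exact_mod_cast hN
  apply eq_of_degree_le_of_eval_index_eq (v := fun m : ZMod N => (stdAddChar (-m) : ℂ)) univ
  · intro a _ b _ hab
    exact neg_injective (injective_stdAddChar hab)
  · rw [Lagrange.degree_nodal]
  · rw [degree_sub_eq_left_of_degree_lt h, Lagrange.degree_nodal, card_univ, ZMod.card,
      degree_X_pow]
  · rw [Lagrange.nodal_monic, leadingCoeff_sub_of_degree_lt h, monic_X_pow]
  · intro i _
    have h0 : ∏ m : ZMod N, ((stdAddChar (-i) : ℂ) - stdAddChar (-m)) = 0 :=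
      Finset.prod_eq_zero (mem_univ i) (sub_self _)
    rw [Lagrange.eval_nodal, h0, eval_sub, eval_pow, eval_X, eval_one,
      ← AddChar.map_nsmul_eq_pow, nsmul_eq_mul, ZMod.natCast_self, zero_mul,
      AddChar.map_zero_eq_one, sub_self]

/-- **`∏_{m ≠ i} |v_i − v_m| = N`** for the roots of unity `v_m = e(−m/N)`: the derivative of
`z^N − 1 = ∏_m (z − v_m)` at the node `v_i` is `N v_i^{N−1}` (Dyatlov–Jin 2017, proof of
Lemma 2.6, "differentiating at `z = 1` the polynomial `z^N − 1`").
[cite: DyatlovJin2017, proof of Lemma 2.6] -/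
private theorem prod_norm_stdAddChar_sub (i : ZMod N) :
    ∏ j ∈ univ.erase i, ‖(stdAddChar (-i) : ℂ) - stdAddChar (-j)‖ = N := by
  have h := Lagrange.eval_nodal_derivative_eval_node_eq
    (v := fun m : ZMod N => (stdAddChar (-m) : ℂ)) (mem_univ i)
  rw [nodal_stdAddChar_neg_eq, Lagrange.eval_nodal, derivative_sub, derivative_one, sub_zero,
    derivative_X_pow, eval_mul, eval_C, eval_pow, eval_X] at h
  rw [← norm_prod, ← h, norm_mul, norm_pow, stdAddChar_norm_eq_one, one_pow, mul_one,
    Complex.norm_natCast]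

end Nodes

/-! ### Lagrange interpolation at unimodular nodes -/

section Interpolation

variable {ι : Type*} [Fintype ι] [DecidableEq ι] {v : ι → ℂ}

/-- **Bound on the Lagrange basis polynomials** (Dyatlov–Jin 2017, proof of Lemma 2.6). For an
injective node map `v` into the closed unit disc with `∏_{j ≠ i} |v_i − v_j| = |ι|` for all `i`
(e.g. the `|ι|`-th roots of unity) and any finite `S`, the Lagrange basis polynomial
`𝓛_i(z) = ∏_{j ∈ S, j ≠ i} (z − v_j)/(v_i − v_j)` satisfies `|𝓛_i(z)| ≤ 2^{|ι|}/|ι|` for `|z| ≤ 1`: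
the numerator is at most `2^{|S|−1}`, and the denominator is
`|ι| / ∏_{j ∉ S} |v_i − v_j| ≥ |ι|/2^{|ι|−|S|}`.
[cite: DyatlovJin2017, proof of Lemma 2.6] -/
theorem norm_eval_lagrange_basis_le (hinj : Function.Injective v) (hv : ∀ m, ‖v m‖ ≤ 1)
    (hprod : ∀ i, ∏ j ∈ univ.erase i, ‖v i - v j‖ = Fintype.card ι)
    (S : Finset ι) (i : ι) {z : ℂ} (hz : ‖z‖ ≤ 1) :
    ‖(Lagrange.basis S v i).eval z‖ ≤ 2 ^ Fintype.card ι / Fintype.card ι := by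
  have h2 : ∀ (s : Finset ι) (w : ℂ), ‖w‖ ≤ 1 → ∏ j ∈ s, ‖w - v j‖ ≤ 2 ^ #s := by
    intro s w hw
    rw [← prod_const]
    exact prod_le_prod (fun j _ => norm_nonneg _) fun j _ =>
      (norm_sub_le _ _).trans (by linarith [hv j])
  have hn : (0 : ℝ) < Fintype.card ι := Nat.cast_pos.2 (Fintype.card_pos_iff.2 ⟨i⟩)
  have hsub : S.erase i ⊆ univ.erase i := erase_subset_erase i (subset_univ S)
  have hD : 0 < ∏ j ∈ S.erase i, ‖v i - v j‖ :=
    prod_pos fun j hj => norm_pos_iff.2 (sub_ne_zero.2 fun h => (mem_erase.1 hj).1 (hinj h).symm)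
  have hED : (∏ j ∈ univ.erase i \ S.erase i, ‖v i - v j‖) * ∏ j ∈ S.erase i, ‖v i - v j‖
      = Fintype.card ι := by
    rw [prod_sdiff hsub, hprod]
  have hcard : #(univ.erase i \ S.erase i) + #(S.erase i) ≤ Fintype.card ι := by
    rw [card_sdiff_add_card_eq_card hsub, card_erase_of_mem (mem_univ i), card_univ]
    exact Nat.sub_le _ _
  have heval : ‖(Lagrange.basis S v i).eval z‖
      = (∏ j ∈ S.erase i, ‖v i - v j‖)⁻¹ * ∏ j ∈ S.erase i, ‖z - v j‖ := by
    simp only [Lagrange.basis, Lagrange.basisDivisor, eval_prod, eval_mul, eval_C, eval_sub,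
      eval_X, norm_prod, norm_mul, norm_inv, prod_mul_distrib, prod_inv_distrib]
  have hDinv : (∏ j ∈ S.erase i, ‖v i - v j‖)⁻¹
      = (∏ j ∈ univ.erase i \ S.erase i, ‖v i - v j‖) / Fintype.card ι := by
    rw [eq_div_iff hn.ne', ← hED, mul_left_comm, inv_mul_cancel₀ hD.ne', mul_one]
  rw [heval, hDinv, div_mul_eq_mul_div]
  refine div_le_div_of_nonneg_right ?_ hn.le
  calc (∏ j ∈ univ.erase i \ S.erase i, ‖v i - v j‖) * ∏ j ∈ S.erase i, ‖z - v j‖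
      ≤ 2 ^ #(univ.erase i \ S.erase i) * 2 ^ #(S.erase i) :=
        mul_le_mul (h2 _ _ (hv i)) (h2 _ _ hz) (prod_nonneg fun _ _ => norm_nonneg _)
          (by positivity)
    _ = 2 ^ (#(univ.erase i \ S.erase i) + #(S.erase i)) := by rw [pow_add]
    _ ≤ 2 ^ Fintype.card ι := pow_le_pow_right₀ (by norm_num) hcard

/-- **Lagrange interpolation bound** (Dyatlov–Jin 2017, proof of Lemma 2.6). Under the hypotheses
of `norm_eval_lagrange_basis_le`, a polynomial `p` of degree `< |S|` is its own Lagrange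
interpolant on the nodes `v_m`, `m ∈ S`, hence `|p(z)| ≤ (2^{|ι|}/|ι|) ∑_{m ∈ S} |p(v_m)|` for
`|z| ≤ 1`. [cite: DyatlovJin2017, proof of Lemma 2.6] -/
theorem norm_eval_le_of_degree_lt_card (hinj : Function.Injective v) (hv : ∀ m, ‖v m‖ ≤ 1)
    (hprod : ∀ i, ∏ j ∈ univ.erase i, ‖v i - v j‖ = Fintype.card ι)
    (S : Finset ι) {p : ℂ[X]} (hp : p.degree < #S) (z : ℂ) (hz : ‖z‖ ≤ 1) :
    ‖p.eval z‖ ≤ 2 ^ Fintype.card ι / Fintype.card ι * ∑ m ∈ S, ‖p.eval (v m)‖ := by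
  have hpi : p = Lagrange.interpolate S v (fun i => p.eval (v i)) :=
    Lagrange.eq_interpolate hinj.injOn hp
  calc ‖p.eval z‖ = ‖∑ i ∈ S, p.eval (v i) * (Lagrange.basis S v i).eval z‖ := by
        conv_lhs => rw [hpi]
        rw [Lagrange.interpolate_apply, eval_finsetSum]
        simp_rw [eval_mul, eval_C]
    _ ≤ ∑ i ∈ S, ‖p.eval (v i)‖ * (2 ^ Fintype.card ι / Fintype.card ι) := by
        refine (norm_sum_le _ _).trans (sum_le_sum fun i _ => ?_)
        rw [norm_mul]
        exact mul_le_mul_of_nonneg_left (norm_eval_lagrange_basis_le hinj hv hprod S i hz)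
          (norm_nonneg _)
    _ = 2 ^ Fintype.card ι / Fintype.card ι * ∑ m ∈ S, ‖p.eval (v m)‖ := by
        rw [← sum_mul, mul_comm]

/-- **Mass of a low-degree polynomial on a node subset** (Dyatlov–Jin 2017, proof of Lemma 2.6,
the "Hölder" step summed over all nodes). Under the hypotheses of `norm_eval_lagrange_basis_le`,
a polynomial `p` of degree `< |S|` has `∑_r |p(v_r)|² ≤ 2^{2|ι|} ∑_{m ∈ S} |p(v_m)|²`.
[cite: DyatlovJin2017, proof of Lemma 2.6] -/
theorem sum_norm_eval_sq_le_of_degree_lt (hinj : Function.Injective v) (hv : ∀ m, ‖v m‖ ≤ 1)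
    (hprod : ∀ i, ∏ j ∈ univ.erase i, ‖v i - v j‖ = Fintype.card ι)
    (S : Finset ι) {p : ℂ[X]} (hp : p.degree < #S) :
    ∑ r, ‖p.eval (v r)‖ ^ 2 ≤ 2 ^ (2 * Fintype.card ι) * ∑ m ∈ S, ‖p.eval (v m)‖ ^ 2 := by
  obtain hn | hn := Nat.eq_zero_or_pos (Fintype.card ι)
  · have : IsEmpty ι := Fintype.card_eq_zero_iff.1 hn
    rw [univ_eq_empty, sum_empty]
    positivity
  have hA := norm_eval_le_of_degree_lt_card hinj hv hprod S hp
  have hnR : (0 : ℝ) < Fintype.card ι := Nat.cast_pos.2 hn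
  have hpt : ∀ r, ‖p.eval (v r)‖ ^ 2 ≤ (2 ^ Fintype.card ι / Fintype.card ι) ^ 2 *
      (Fintype.card ι * ∑ m ∈ S, ‖p.eval (v m)‖ ^ 2) := by
    intro r
    calc ‖p.eval (v r)‖ ^ 2
        ≤ (2 ^ Fintype.card ι / Fintype.card ι * ∑ m ∈ S, ‖p.eval (v m)‖) ^ 2 := by
          gcongr
          exact hA (v r) (hv r)
      _ = (2 ^ Fintype.card ι / Fintype.card ι) ^ 2 * (∑ m ∈ S, ‖p.eval (v m)‖) ^ 2 :=
          mul_pow _ _ _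
      _ ≤ (2 ^ Fintype.card ι / Fintype.card ι) ^ 2 * (#S * ∑ m ∈ S, ‖p.eval (v m)‖ ^ 2) := by
          gcongr
          exact sq_sum_le_card_mul_sum_sq
      _ ≤ (2 ^ Fintype.card ι / Fintype.card ι) ^ 2 *
          (Fintype.card ι * ∑ m ∈ S, ‖p.eval (v m)‖ ^ 2) := by
          gcongr
          exact_mod_cast card_le_univ S
  calc ∑ r, ‖p.eval (v r)‖ ^ 2
      ≤ ∑ _r : ι, (2 ^ Fintype.card ι / Fintype.card ι) ^ 2 *
          (Fintype.card ι * ∑ m ∈ S, ‖p.eval (v m)‖ ^ 2) :=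
        sum_le_sum fun r _ => hpt r
    _ = 2 ^ (2 * Fintype.card ι) * ∑ m ∈ S, ‖p.eval (v m)‖ ^ 2 := by
        rw [sum_const, card_univ, nsmul_eq_mul, pow_mul']
        field_simp

end Interpolation

/-! ### The generating polynomial and the shift -/

section Main

variable {N : ℕ} [NeZero N]

/-- **`𝓕u(k) = e(−ck/N) · p(e(−k/N))`** for the (shifted) generating polynomial
`p(z) = ∑_x u(x) z^{(x−c).val}` (Dyatlov–Jin 2017, proof of Lemma 2.6:
"`ℱ_N u(j) = N^{-1/2} p(ω_N^j)`", combined with the cyclic shift (2.5)).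
[cite: DyatlovJin2017, proof of Lemma 2.6] -/
theorem dft_eq_stdAddChar_mul_eval (u : ZMod N → ℂ) (c k : ZMod N) :
    𝓕 u k = stdAddChar (-(c * k)) *
      (∑ x : ZMod N, C (u x) * X ^ (x - c).val).eval (stdAddChar (-k)) := by
  rw [dft_apply, eval_finsetSum, mul_sum]
  refine sum_congr rfl fun x _ => ?_
  rw [smul_eq_mul, eval_mul, eval_C, eval_pow, eval_X]
  have hx : x = c + ((x - c).val : ZMod N) := by rw [natCast_zmod_val]; ring
  have hchar : (stdAddChar (-(x * k)) : ℂ)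
      = stdAddChar (-(c * k)) * stdAddChar (-k) ^ (x - c).val := by
    rw [← AddChar.map_nsmul_eq_pow, ← AddChar.map_add_eq_mul]
    congr 1
    rw [nsmul_eq_mul]
    conv_lhs => rw [hx]
    ring
  rw [hchar]
  ring

/-- **The shift step** (Dyatlov–Jin 2017, proof of Lemma 2.6: "by cyclically shifting `Y` … we may
assume `Y ⊂ {0,…,N−L−1}`"). If `j, j+1, …, j+L−1 ∉ Y` and `L < N`, then with `c = j + L` every
`x ∈ Y` has `(x − c).val < N − L`. [cite: DyatlovJin2017, proof of Lemma 2.6] -/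
theorem val_sub_lt_of_gap {Y : Finset (ZMod N)} {L : ℕ} {j : ZMod N}
    (hgap : ∀ i : ℕ, i < L → j + (i : ZMod N) ∉ Y) (hL : L < N) {x : ZMod N} (hx : x ∈ Y) :
    (x - (j + L)).val < N - L := by
  by_contra h
  replace h := not_lt.1 h
  have htN : (x - (j + L)).val < N := ZMod.val_lt _
  have hi : (x - (j + L)).val - (N - L) < L := by omega
  refine hgap _ hi ?_
  have hcast : (((x - (j + L)).val - (N - L) : ℕ) : ZMod N) = x - j := by
    have h1 : (x - (j + L)).val - (N - L) + N = (x - (j + L)).val + L := by omega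
    have h2 := congrArg (Nat.cast : ℕ → ZMod N) h1
    simp only [Nat.cast_add] at h2
    rw [ZMod.natCast_self, add_zero, ZMod.natCast_zmod_val] at h2
    rw [h2]
    ring
  have hxj : j + (x - j) = x := by ring
  rw [hcast, hxj]
  exact hx

/-- Degree bound for the generating polynomial: if `u(x) ≠ 0` forces `(x − c).val < d`, then
`deg (∑_x u(x) X^{(x−c).val}) < d`. [folklore] -/
theorem degree_genPoly_lt (u : ZMod N → ℂ) (c : ZMod N) {d : ℕ}
    (hu : ∀ x, u x ≠ 0 → (x - c).val < d) :
    (∑ x : ZMod N, C (u x) * X ^ (x - c).val).degree < (d : WithBot ℕ) := by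
  refine (degree_sum_le _ _).trans_lt
    ((Finset.sup_lt_iff (WithBot.bot_lt_coe d)).2 fun x _ => ?_)
  by_cases hx : u x = 0
  · simp [hx]
  · rw [degree_C_mul_X_pow _ hx, Nat.cast_withBot]
    exact WithBot.coe_lt_coe.2 (hu x hx)

/-- **Dyatlov–Jin 2017, Lemma 2.6 (the gap lemma)** — discharge of the named fact
`dyatlovJin2017_lemma_2_6`: for `X, Y ⊆ ℤ/N`, `L < N`, `|X| ≤ L` and `Y` missing the `L`
consecutive residues `j, …, j+L−1`, every `u` supported in `Y` has
`∑_{k ∈ X} ‖𝓕u(k)‖² ≤ (1 − 2^{−2N}) · N · ‖u‖²`, i.e. `‖𝟙_X ℱ_N 𝟙_Y‖ ≤ √(1 − 2^{−2N})`.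
Proof as printed: shift, generating polynomial, Lagrange interpolation at the roots of unity
outside `X`, Cauchy–Schwarz, Plancherel.
[cite: DyatlovJin2017, Lemma 2.6 (arXiv:1608.02238 §2.3)] -/
theorem dyatlovJin2017_lemma_2_6_holds : dyatlovJin2017_lemma_2_6 := by
  intro N _ X Y L _ hLN hXL hgap u hu
  obtain ⟨j, hj⟩ := hgap
  -- the shift `c`, the nodes `v`, the generating polynomial `p`
  obtain ⟨c, hc⟩ : ∃ c : ZMod N, c = j + (L : ZMod N) := ⟨_, rfl⟩
  obtain ⟨v, hv⟩ : ∃ v : ZMod N → ℂ, ∀ m, v m = stdAddChar (-m) := ⟨_, fun _ => rfl⟩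
  obtain ⟨p, hp⟩ : ∃ p : ℂ[X], p = ∑ x : ZMod N, C (u x) * Polynomial.X ^ (x - c).val :=
    ⟨_, rfl⟩
  have hv1 : ∀ m, ‖v m‖ ≤ 1 := fun m => by rw [hv]; exact (stdAddChar_norm_eq_one (-m)).le
  have hinj : Function.Injective v := fun a b h => by
    rw [hv, hv] at h
    exact neg_injective (injective_stdAddChar h)
  have hprod : ∀ i, ∏ m ∈ univ.erase i, ‖v i - v m‖ = Fintype.card (ZMod N) := fun i => by
    simp_rw [hv]
    rw [ZMod.card]
    exact prod_norm_stdAddChar_sub i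
  -- Step 2: `‖𝓕 u k‖ = ‖p (v k)‖`
  have hnorm : ∀ k, ‖𝓕 u k‖ = ‖p.eval (v k)‖ := fun k => by
    rw [hp, hv, dft_eq_stdAddChar_mul_eval u c k, norm_mul, stdAddChar_norm_eq_one, one_mul]
  -- Step 1: `deg p < N - L ≤ N - |X| = |Xᶜ|`
  have hdeg : p.degree < #(Xᶜ) := by
    have h1 : p.degree < ((N - L : ℕ) : WithBot ℕ) := by
      rw [hp]
      refine degree_genPoly_lt u c fun x hx => ?_
      rw [hc]
      refine val_sub_lt_of_gap hj hLN ?_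
      by_contra hxY
      exact hx (hu x hxY)
    refine h1.trans_le ?_
    rw [card_compl, ZMod.card]
    exact_mod_cast Nat.sub_le_sub_left hXL N
  -- Steps 3–4: Lagrange interpolation + Cauchy–Schwarz, summed over the nodes
  have hkey : ∑ r, ‖p.eval (v r)‖ ^ 2 ≤ 2 ^ (2 * N) * ∑ m ∈ Xᶜ, ‖p.eval (v m)‖ ^ 2 := by
    have := sum_norm_eval_sq_le_of_degree_lt hinj hv1 hprod Xᶜ hdeg
    rwa [ZMod.card] at this
  simp_rw [← hnorm] at hkey
  -- Step 5: Plancherel and bookkeeping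
  have hsplit : ∑ m ∈ Xᶜ, ‖𝓕 u m‖ ^ 2 = ∑ r, ‖𝓕 u r‖ ^ 2 - ∑ k ∈ X, ‖𝓕 u k‖ ^ 2 :=
    eq_sub_of_add_eq (sum_compl_add_sum X fun m => ‖𝓕 u m‖ ^ 2)
  have hplan := sum_norm_sq_dft u
  have h2N : (2 : ℝ) ^ (-(2 * (N : ℝ))) = ((2 : ℝ) ^ (2 * N))⁻¹ := by
    rw [Real.rpow_neg zero_le_two, show (2 * (N : ℝ)) = ((2 * N : ℕ) : ℝ) by push_cast; ring,
      Real.rpow_natCast]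
  have hc0 : (0 : ℝ) < 2 ^ (2 * N) := by positivity
  have hr : (0 : ℝ) ≤ 1 - ((2 : ℝ) ^ (2 * N))⁻¹ :=
    sub_nonneg.2 (inv_le_one_of_one_le₀ (one_le_pow₀ (by norm_num)))
  rw [h2N, Real.sq_sqrt hr, mul_assoc, ← hplan]
  rw [hsplit] at hkey
  have h5 : (∑ r, ‖𝓕 u r‖ ^ 2) / 2 ^ (2 * N) ≤ ∑ r, ‖𝓕 u r‖ ^ 2 - ∑ k ∈ X, ‖𝓕 u k‖ ^ 2 := by
    rw [div_le_iff₀ hc0]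
    linarith
  calc ∑ k ∈ X, ‖𝓕 u k‖ ^ 2 ≤ ∑ r, ‖𝓕 u r‖ ^ 2 - (∑ r, ‖𝓕 u r‖ ^ 2) / 2 ^ (2 * N) := by
        linarith
    _ = (1 - ((2 : ℝ) ^ (2 * N))⁻¹) * ∑ r, ‖𝓕 u r‖ ^ 2 := by ring

end Main

end Literature.Analysis.Fourier

end
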